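import Mathlib
import Literature.MathematicalPhysics.QuantumFieldTheory.Borinsky2020.ConvergenceTheorem
import Literature.MathematicalPhysics.QuantumFieldTheory.Borinsky2020.HeppSectorCoordinates
import Literature.MathematicalPhysics.QuantumFieldTheory.Borinsky2020.SectorTableRecursion
import HarnessLib

/-!
# Borinsky's tropical sampling algorithm for generalized permutahedra (AIHPD 2023 = arXiv:2008.12310, §6.2: **Theorem 27** — the geometric sector decomposition `I[f] = Σ_σ (1/Π_k r(A^σ_k)) ∫_{[0,1]^{n−1}} f(x^{(σ)}(ξ)) dξ` —, **eq. (40)** `I^tr = Σ_σ I^tr_{C_σ}`, **Proposition 29** `I^tr = J_r([n])`, and **Proposition 31**: Algorithm 4 generates samples distributed as the tropical measure `μ^tr` of eq. (mu_probability)) — PROVED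

independent recomputation; certified where stated, statistical where stated; no new-physics claim.

CITATION HEADER (venture `QEDPrecision`, cell `pub-qed`, track TROPICAL, LIT seat `pub-qed-trop-lit` gen 26; VALUE-FREE: statements about
ABSTRACT polynomials, polytopes, one parametric integral form and one abstract sampling algorithm — no Feynman graph, no Monte-Carlo
value, nothing per word or per Set V family). CLOSES the step that the companion files name as the one left between them:
`ConvergenceTheorem.lean` (gen 25) types `μ^tr` and `I = I^tr ∫ R_{a/b} μ^tr` and lists "NOT typed: … Theorem 27's sector VALUE
`I^tr_{C_σ} = 1/Π_k r(A^σ_k)` (eq. (40) …); that Algorithms 3 / 4 SAMPLE from `μ^tr` (Proposition 31: the law of their output is the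
measure typed here) — the remaining DERIVED step between this file and `TropicalSamplingEstimator.lean`"; `SectorTableRecursion.lean`
types Definition 28, Proposition 29's identity and Algorithm 4's DISCRETE part (`runProb_eq`) and lists "NOT typed: the continuous part
of Algorithm 4 / Proposition 31 (the `ξ^{1/r(A)}` coordinates realise the per-sector measure of Theorem 27)"; `ConeIntegral.lean` has
Lemma 17 for ONE simplicial cone in affine coordinates; `HeppSectorDecomposition.lean` the braid-fan partition `∫ = Σ_σ ∫_{C_σ}`.
Here the four are ASSEMBLED: with this file the one-quotient kernel chain of the track's source sheet (`tropical/lit/SOURCES.md` §1,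
A13/A16/A23/A24) reads R1 ∧ R2 (generalized-permutahedron form: `r > 0`) ⇒ `I^tr = J_r([n]) ∈ (0,∞)` and `μ^tr` a probability measure
⇒ **Algorithm 4's output has law `μ^tr`** (this file) ⇒ `TropicalSamplingEstimator.lean` (unbiasedness, `var = C/N`, √N-CLT for
bounded `R_{a/b}`, which R3 gives by `TropicalLowerBound.exists_abs_residual_le`). Serves: `tropical/lit/SOURCES.md` §1.5–§1.6 / A26,
ORACLE-MAP §0b clause (i) and §6 (formal-objects list), E2/E3 (what "the sampler draws from μ^tr" means as a theorem), T1/T2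
(the per-sector exponents `r(A^σ_k)` ARE the rates of the sampling law, sector by sector).

Source [Borinsky2020]: M. Borinsky, "Tropical Monte Carlo quadrature for Feynman integrals", Ann. Inst. Henri Poincaré D 10 (2023) 635–685,
doi:10.4171/aihpd/158 = arXiv:2008.12310v2 (LaTeX e-print held by the cell, HOME `data/lit/sources/.cache/2008.12310/tropical.tex`; theorem
numbers = the e-print's single shared counter as in the companion files; journal concordance (source sheet §1.9 / A4.1): e-print Theorem 27 =
AIHPD Thm 6.6, eq. (40) = (6.4), Definition 28 = Def. 6.7, Proposition 29 = Prop. 6.8, Proposition 31 = Prop. 6.10, eq. (mu_probability) =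
(5.2), Lemma 17 = Lemma 4.3). VERBATIM. eq. (CsigmaWeyl)–(CsigmaWeylexplicit) (tex l.1002–1008): "C_σ = { y ∈ ℝⁿ/𝟙ℝ : y_{σ(1)} ≤ … ≤
y_{σ(n)} } such a domain is called a Weyl chamber. It is not hard to see that these are simplicial cones as C_σ = { Σ_{k=1}^{n−1} λ_k u^{(σ,k)} :
λ_k ≥ 0 } with u^{(σ,k)}_{σ(i)} = −1 if k ≤ i, 0 else where we chose the set of representatives in ℝⁿ of the vectors in u^{(σ,k)} ∈ ℝⁿ/𝟙ℝ
by fixing u^{(σ,k)}_{σ(n)} = 0". **Theorem 27** (geometric sector decomposition for generalized permutahedra, l.1063–1085): "Let 𝒜 and ℬ be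
the polytopes defined in Theorem 3. If 𝒜 and ℬ are generalized permutahedra with associated boolean functions z_𝒜, z_ℬ : 2^[n] → ℝ which
fulfill the requirements R1 and R2 of Theorem 3, then we can write the integral I[f] = ∫_{ℙ^{n−1}_{>0}} (Π_i a_i^tr(x)^{Re ν_i}/Π_j
b_j^tr(x)^{Re ρ_j}) f(x) Ω as a sum I[f] = Σ_{σ∈S_n} I_σ[f] with I_σ[f] = (1/Π_{k=1}^{n−1} r(A^σ_k)) ∫_{[0,1]^{n−1}} f(x^{(σ)}(ξ))
Π_{k=1}^{n−1} dξ_k, where f : ℙ^{n−1}_{>0} → ℂ is a measurable homogeneous function of degree 0, A^σ_k = {σ(1), …, σ(k)} ⊂ [n] = {1,…,n},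
r(A) = z_𝒜(A) − z_ℬ(A), which fulfills r(A) > 0 for all non-empty proper subsets A ⊊ [n] and x^{(σ)}(ξ) ∈ Exp(C_σ) is given
component-wise by x_{σ(k)} = Π_{i=k}^{n−1} ξ_i^{1/r(A^σ_i)} and x_{σ(n)} = 1." Its proof (l.1086–1096): "This theorem is a specialization of
Theorem 19 to the generalized permutahedron case. The braid arrangement fan defined in eq. (CsigmaWeyl) provides an appropriate reduced
simplicial fan. By Lemma 26 we have vertices w^{(σ,z_𝒜)} ∈ 𝒜 and w^{(σ,z_ℬ)} ∈ ℬ such that ⟨y, w^{(σ,z_𝒜)}⟩ = max_{v∈𝒜}⟨y,v⟩ and ⟨y,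
w^{(σ,z_ℬ)}⟩ = max_{v∈ℬ}⟨y,v⟩ for all σ ∈ S_n and y ∈ C_σ. … ⟨u^{(σ,k)}, w^{(σ,z_ℬ)}⟩ − ⟨u^{(σ,k)}, w^{(σ,z_𝒜)}⟩ = z_𝒜(A^σ_k) −
z_ℬ(A^σ_k) > 0 … which implies r(A) > 0 for all non-empty A ⊊ [n]. From the form of the u^{(σ,k)} vectors in eq. (CsigmaWeylexplicit) it
is obvious that |det(u^{(σ,1)}, …, u^{(σ,n−1)}, 𝟙)| = 1." **eq. (40)** (l.1102–1106): "the overall normalization factor needed to apply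
Algorithm 3 is given by I^tr = Σ_{σ∈S_n} I^tr_{C_σ} with I^tr_{C_σ} = 1/Π_{k=1}^{n−1} r(A^σ_k), (40) where r(A) = z_𝒜(A) − z_ℬ(A) for all
non-empty A ⊊ [n]. … it will be convenient to declare r(∅) = 1". **Definition 28 / Proposition 29** (l.1107–1122): "J_r(A) = Σ_{e∈A}
J_r(A∖e)/r(A∖e) for all non-empty A ⊂ [n] where J_r(∅) = 1. … If r(A) = z_𝒜(A) − z_ℬ(A) for all non-empty A ⊊ [n] and r(∅) = 1, then
I^tr = J_r([n]). Proof. We will prove that J_r(A) = Σ_{σ:[m]→A} 1/Π_{k=1}^{m−1} r(A^σ_k), where the sum is over all bijections σ : [m] → A. …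
Decomposing the sum in this way and using eq. (40) gives the statement." **Algorithm 4** (to generate a sample from μ^tr for generalized
permutahedra, l.1126–1144): "Set A = [n] and κ = 1. while A ≠ ∅: Pick a random e ∈ A with probability p_e = (1/J_r(A)) J_r(A∖e)/r(A∖e).
Remove e from A, i.e. set A ← A∖e. Set σ(|A|) = e. Set x_e = κ. Pick a uniformly distributed random number ξ ∈ [0,1]. Set κ ← κ ξ^{1/r(A)}.
end while. Return x = [x_1,…,x_n] ∈ Exp(C_σ) ⊂ ℙ^{n−1}_{>0} and σ = (σ(1),…,σ(n)) ∈ S_n." **Proposition 31** (l.1146–1158): "If r(A) =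
z_𝒜(A) − z_ℬ(A) for all non-empty A ⊊ [n], r(∅) = 1 and J_r is the boolean function given in Definition 28, then Algorithm 4 generates a
sample x ∈ ℙ^{n−1}_{>0}, distributed as μ^tr in eq. (mu_probability) in the generalized permutahedron case. Proof. For any test function
f : ℙ^{n−1}_{>0} → ℂ and a random sample x ∈ ℙ^{n−1}_{>0} generated by Algorithm 4, E[f(x)] = Σ_{e_n∈A_n} (1/J_r(A_n)) J_r(A_n∖e_n)/r(A_n∖e_n)
… Σ_{e_1∈A_1} (1/J_r(A_1)) J_r(A_1∖e_1)/r(A_1∖e_1) ∫_{[0,1]^{n−1}} f(x(ξ)) Π dξ_k, where … x(ξ) is component-wise x_{e_k} = Π_{i=k}^{n−1}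
ξ_i^{1/r(A_i)}. We identify A_k∖e_k = A_{k−1}. The terms J_r(A_k∖e_k) telescope, J_r(∅) = r(∅) = 1 and we get E[f(x)] = (1/J_r(A_n))
Σ_{e_n∈A_n} … Σ_{e_1∈A_1} (1/(r(A_n)⋯r(A_1))) ∫_{[0,1]^{n−1}} f(x(ξ)) Π dξ_k. The sum can be written as a sum over all permutations in σ ∈ S_n
and A_k = A^σ_k. The statement follows from Proposition 29 and Theorem 27." §5 eq. (mu_probability) (l.887–893): "I^tr = ∫ Π_i a_i^tr(x)^{Re
ν_i}/Π_j b_j^tr(x)^{Re ρ_j} Ω … we can define a probability distribution given by the differential form μ^tr = (1/I^tr) Π_i a_i^tr(x)^{Re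
ν_i}/Π_j b_j^tr(x)^{Re ρ_j} Ω, such that 1 = ∫ μ^tr." eq. (integral_euler_mellin) (l.237–241): "The integral … can be written as an integral
over the positive orthant … by picking an affine chart for projective space, for instance I = ∫_{ℝ^{n−1}_{>0}} (…)|_{x_n=1} Π_{k=1}^{n−1}
dx_k/x_k". Lemma 17 proof (l.762, l.773): "Start by changing to logarithmic coordinates x = e^y … We can therefore change variables via λ_k =
−(1/⟨u^{(k)},w⟩) log ξ_k which proves the statement."

TYPING (as in `ConvergenceTheorem.lean`: ambient dimension written `n + 1`, variables `x_0, …, x_n : Fin (n+1)`, so the printed `S_n`,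
`[0,1]^{n−1}`, `A^σ_k = {σ(1),…,σ(k)}` read `Equiv.Perm (Fin (n+1))`, `unitCube n = (0,1)^n` of `ConeIntegral.lean`, `chainSet σ k =
{σ 0, …, σ (k−1)}` of `GeneralizedPermutahedronVertex.lean`; REAL exponents `ν_i, ρ_j ≥ 0` = the printed `Re ν_i, Re ρ_j`; NO new
definition — D-0026 economy — the Newton polytopes / Minkowski sums are written out with the same local notation `NP⟦·⟧` as the companion,
and the sample map, the chart and Algorithm 4's law are written in place). Every integral statement is in the CHART `x_n = 1` of
eq. (integral_euler_mellin) in logarithmic coordinates `y ∈ ℝⁿ`, `x = e^{(y,0)}` — the chart in which the companion types `I^tr` and `μ^tr`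
(`integral_tropical_pos_of_gap`, `isProbabilityMeasure_tropicalMeasure_of_gap`); the printed test function "f : ℙ^{n−1}_{>0} → ℂ measurable
homogeneous of degree 0" is a measurable `f : (Fin (n+1) → ℝ) → ℝ` with `f(c·x) = f(x)` for `c > 0` on the positive orthant, assumed
BOUNDED (the print leaves the existence of the integrals implicit), and `I[f] = ∫_{ℝⁿ} T(y) f(e^{(y,0)}) dy` with `T(y) =
Π_i a_i^tr(e^{(y,0)})^{ν_i}/Π_j b_j^tr(e^{(y,0)})^{ρ_j}`; the printed `x^{(σ)}(ξ)` IS the vector `m ↦ Π_{i ≥ σ⁻¹(m)} ξ_i^{1/r(A^σ_{i+1})}`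
(0-indexed positions; `x_{σ(n)} = 1` is the empty product) at which `f` is evaluated. HYPOTHESES of the four main theorems: `a_i, b_j ≠ 0`,
`ν, ρ ≥ 0`, `z_𝒜, z_ℬ` supermodular with `z(∅) = 0` and `𝒜 = Σ_i ν_i NP_{a_i} = 𝒢_{z_𝒜}`, `ℬ = Σ_j ρ_j NP_{b_j} = 𝒢_{z_ℬ}` as sets (Theorem
27's "generalized permutahedra with associated boolean functions", the presentation of Theorem 23 as typed in the companion), `r(A) =
z_𝒜(A) − z_ℬ(A) > 0` on the non-empty proper subsets and `z_𝒜([n]) = z_ℬ([n])` (eq. (homogeneous)). REMARK on R1/R2: the print assumes R1 ∧ R2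
and DERIVES `r > 0` in the proof; we assume `r > 0` directly — for generalized permutahedra it gives back R2 (Corollary 24,
`gpPolytope_subset_intrinsicInterior` of `GeneralizedPermutahedronInterior.lean`) and, by the Abel summation `gap_of_gp` below, Lemma 15's
gap with `ε = min_A r(A)`, which is all that the companion's `I^tr`/`μ^tr` theorems consume; R1 is not used. Algorithm 4's output LAW is
written as the finite mixture, over `σ ∈ S_{n+1}`, with the weights `runProb r [n] (σ(n), …, σ(0))` of `SectorTableRecursion.lean` (the
product of the printed one-step probabilities `p_e` along the run that removes `σ(n)` first, …, `σ(0)` last — the `ξ`'s being drawn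
independently of the `e`'s), of the images of the uniform law on `[0,1]^n` under `ξ ↦ x^{(σ)}(ξ)` (read in the chart through
`x ↦ (log(x_j/x_n))_{j<n}` for the measure identity).

PROOF ROUTE (disclosed; the printed one, with the projective bookkeeping made explicit). (1) `I[f]`, a chart integral over `ℝⁿ`, is
rewritten as the `𝟙`-AVERAGED integral `∫_{ℝ^{n+1}} T̃(ỹ) f(e^{ỹ}) h(ỹ_n) dỹ`, `h = 𝟙_{[0,1]}`, using that `ỹ ↦ T̃(ỹ) f(e^ỹ)` is invariant under
`ỹ ↦ ỹ + c𝟙` (degree-0 homogeneity: for `T̃` this is `⟨𝟙, w^{(σ,z_ℬ)} − w^{(σ,z_𝒜)}⟩ = z_ℬ([n]) − z_𝒜([n]) = 0` chamber by chamber) and the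
shear `(s, y) ↦ (y, 0) + s𝟙` (`integral_mul_apply_last_eq`; Mathlib's `volume_preserving_piFinSuccAbove` + `MeasurePreserving.skew_product`).
(2) "I = Σ_C I_C" over the braid fan: `HeppSectorDecomposition.integral_eq_sum_integral_weylChamber`. (3) On `C_σ` the tropical part is the
monomial `e^{−⟨ỹ, w_σ⟩}`, `w_σ = w^{(σ,z_ℬ)} − w^{(σ,z_𝒜)}` (Lemma 26 ⇒ Lemma 16: `prod_trop_rpow_div_eq_exp_neg_dotProduct_of_gp` of the
companion). (4) Lemma 17 for the chamber, in POSITION coordinates `ỹ' = ỹ ∘ σ` (`HeppSectorCoordinates.permCoords`, measure preserving): the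
chamber `{ỹ'_0 ≤ ⋯ ≤ ỹ'_n}` is, up to the null set of ties (`HeppSectorDecomposition.ae_injective`), the image of `{τ > 0} × ℝ` under the
linear map `(τ, s) ↦ s𝟙 + Σ_i τ_i u^{(i+1)}`, `u^{(i+1)} = −1_{positions ≤ i}` — the printed generators bordered by `𝟙` — whose matrix is
triangular with `|det| = 1` (`abs_det_chamberMatrix`, Mathlib's `det_of_upperTriangular`; the printed "it is obvious that |det(…, 𝟙)| = 1");
Mathlib's Jacobian theorem `integral_image_eq_integral_abs_det_fderiv_smul`; in these coordinates `⟨ỹ, w_σ⟩ = Σ_i r(A^σ_{i+1}) τ_i` (Abel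
summation, `chamberMatrix_mulVec_snoc_dotProduct` + `sum_chainSet_ftVertex_sub`), the `s`-integral factors off after the shear
`s ↦ s + Σ_{i ≥ σ⁻¹(n)} τ_i` (`∫ h = 1`), and the gaps `τ_i ~ Exp(r(A^σ_{i+1}))` are sent onto the unit cube by the printed substitution
`τ_i = −log ξ_i / r(A^σ_{i+1})` (`ConeIntegral.integral_unitCube_comp_logMap`), giving `I_σ[f] = (Π_i 1/r(A^σ_{i+1})) ∫_{[0,1]^n} f(x^{(σ)}(ξ)) dξ`
with `log x^{(σ)}(ξ)_m = Σ_{i ≥ σ⁻¹(m)} log ξ_i / r(A^σ_{i+1})`. (5) `f ≡ 1` gives eq. (40); the bijection `σ ↦ (σ(n), …, σ(0))` between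
`S_{n+1}` and the removal sequences of `SectorTableRecursion` (`sum_orderings_univ_eq_sum_perm`, `orderingWeight_reverse_ofFn`) turns
`sectorTable_eq_sum_orderingWeight` into Proposition 29 and `runProb_eq` into `runProb = I^tr_{C_σ}/J_r([n])`; Proposition 31 follows as
printed ("The statement follows from Proposition 29 and Theorem 27") together with the companion's `I = I^tr ∫ R μ^tr`
(`integral_mul_eq_integral_mul_integral_withDensity`), and the measure identity by testing against `𝟙_S ∘ chart`.

PROVED (0 named facts, D-0026; Mathlib + the companion files only):
* the chamber parametrisation (position coordinates): `chamberMatrix_mulVec` / `_last` / `_succ_sub` / `_snoc` / `_snoc_eq_add` /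
  `_snoc_dotProduct`, **`abs_det_chamberMatrix`** (`|det(u^{(1)},…,u^{(n)},𝟙)| = 1`), `image_chamberMatrix_mulVec` (onto the open chamber),
  `weylChamber_one_ae_eq_strictMono`, **`setIntegral_weylChamber_one_eq_gapDomain`** (Jacobian change of variables), `measurePreserving_snocEquiv`,
  `setIntegral_gapDomain_eq_prod`, **`setIntegral_weylChamber_one_mul_exp`** / **`…_eq_unitCube`** (Lemma 17 for the chamber, `ξ`-form),
  `setIntegral_weylChamber_eq_one` (relabelling by `σ`), **`setIntegral_weylChamber_mul_exp_eq_unitCube`** (all `σ`: `∫_{C_σ} G e^{−⟨y,w⟩} h(y_n)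
  = (∫h)·Π_i c_i⁻¹·∫_{[0,1]^n} G(log x^{(σ)}(ξ)) dξ`, `c_i = −Σ_{A^σ_{i+1}} w`);
* the chart as a `𝟙`-average: **`integral_mul_apply_last_eq`**, `integrable_mul_apply_last`;
* permutations ↔ Algorithm 4's removal sequences: `reverse_ofFn_mem_orderings`, **`orderingWeight_reverse_ofFn`** (`= Π_{k=1}^{n} 1/r(A^σ_k)`),
  **`sum_orderings_univ_eq_sum_perm`**, `sum_perm_prod_inv_eq_sectorTable` (`Σ_σ Π 1/r(A^σ_k) = J_r([n])`), **`runProb_reverse_ofFn`**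
  (`= I^tr_{C_σ}/J_r([n])`);
* generalized permutahedra: `sum_ftVertex_sub_eq_zero` (`⟨𝟙,w_σ⟩ = 0`), `neg_sum_chainSet_ftVertex_sub` (rates `r(A^σ_{i+1})`),
  `chainSet_succ_nonempty` / `_ne_univ`, `chainSet_rate_pos`, `exists_pos_le_rate`, `add_const_mem_weylChamber`, **`gap_of_gp`** (Lemma 15's gap
  from `r ≥ ε` by Abel summation — so every `…_of_gap` theorem of the companion applies WITHOUT R1), **`tropWeight_add_const`** (degree-0
  homogeneity of the tropical weight), `continuous_tropWeight`, `continuous_snoc_zero`;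
* **Theorem 27** `integral_tropical_mul_eq_sum_perm_of_gp`; **eq. (40)** `integral_tropical_eq_sum_perm_of_gp`; **Proposition 29**
  `integral_tropical_eq_sectorTable_of_gp` (`I^tr = J_r([n])`, `r(∅) = 1`); **Proposition 31** `algorithm4_expectation_eq_integral_tropicalMeasure`
  (`E_{Alg.4}[f(x)] = ∫ f dμ^tr` for bounded measurable degree-0-homogeneous `f`) and **`algorithm4_law_eq_tropicalMeasure`** (the law of
  Algorithm 4's output, read in the chart, IS `μ^tr` — an identity of measures on `ℝⁿ`).
NOT typed: Theorem 19 / Algorithm 3 / Proposition 20 for a GENERAL simplicial fan (only the braid fan of the generalized-permutahedron case);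
complex exponents and ℂ-valued test functions; unbounded (merely μ^tr-integrable) test functions; chart-independence of `I[f]` as a
projective integral (one chart, as in the companion); the sampling COST statements (table of size `2ⁿ`, `O(n 2ⁿ)` preprocessing, l.1159) and
§7's identification `z = ` graph data (Theorem 34 ff.) — nothing here is about Feynman graphs; nothing on subtracted / signed integrands.
(Filed by the pub-qed TROPICAL literature seat `pub-qed-trop-lit` gen 26; `tropical/lit/SOURCES.md` A26.)
-/

noncomputable section

namespace Literature.MathematicalPhysics.QuantumFieldTheory.Borinsky2020

/-- The exponent vectors `ℓ ∈ supp(p) ⊂ ℤⁿ` of `p` "interpreted as vectors in ℝⁿ" (tropical.tex l.297–299) — the same local notation as in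
`ConvergenceTheorem.lean` (no new definition is introduced). -/
local notation3 (prettyPrint := false) "pts⟦" p "⟧" =>
  ((fun d : (_ →₀ ℕ) => fun k => ((d k : ℕ) : ℝ)) '' {d | d ∈ MvPolynomial.support p})

/-- The Newton polytope `NP_p = conv(supp p)` — the same local notation as in `ConvergenceTheorem.lean` (no new definition is introduced). -/
local notation3 (prettyPrint := false) "NP⟦" p "⟧" => convexHull ℝ pts⟦p⟧

section ChamberParametrisation

open MeasureTheory Set Real Finset Matrix

variable {n : ℕ}

/-- The generator matrix of the standard Weyl chamber `y_0 ≤ y_1 ≤ ⋯ ≤ y_n` in POSITION coordinates, bordered by the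
`𝟙`-direction: column `castSucc i` is `u^{(i+1)} = −1_{positions ≤ i}` (eq. (CsigmaWeylexplicit): the representatives with last entry `0`;
the print's index convention is read so that `C_σ` is `y_{σ(1)} ≤ ⋯ ≤ y_{σ(n)}`), column `last` is `𝟙`; so `𝐔 (τ, s) = s𝟙 + Σ_i τ_i u^{(i+1)}`,
i.e. `y_m = s − Σ_{i ≥ m} τ_i`. Local notation only (no new definition is introduced). -/
local notation3 "𝐔[" n "]" => (Matrix.of fun m c : Fin (n + 1) =>
  if c = Fin.last n then (1 : ℝ) else if (m : ℕ) ≤ (c : ℕ) then (-1 : ℝ) else 0)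

/-! ### The chamber parametrisation `y = 𝐔 (τ, s)` in position coordinates -/

/-- `(𝐔 u)_m = u_n − Σ_{i ≥ m} u_i`: the chamber parametrisation `y = s𝟙 + Σ_i τ_i u^{(i+1)}` in position coordinates, `u^{(i+1)} = −1_{positions ≤ i}` (the printed generators of eq. (CsigmaWeylexplicit), representatives with last entry `0`, bordered by the column `𝟙`). [cite: Borinsky2020, eq. (CsigmaWeylexplicit) (tropical.tex l.1005–1008); proof of Theorem 27 (l.1093–1096)] -/
theorem chamberMatrix_mulVec (u : Fin (n + 1) → ℝ) (m : Fin (n + 1)) :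
    (𝐔[n] *ᵥ u) m = u (Fin.last n) - ∑ i ∈ univ.filter (fun i : Fin n => (m : ℕ) ≤ (i : ℕ)), u (Fin.castSucc i) := by
  simp only [Matrix.mulVec, dotProduct, Matrix.of_apply]
  rw [Fin.sum_univ_castSucc, if_pos rfl, one_mul]
  have hcs : ∀ i : Fin n, (if Fin.castSucc i = Fin.last n then (1 : ℝ)
        else if (m : ℕ) ≤ ((Fin.castSucc i : Fin (n + 1)) : ℕ) then -1 else 0) * u (Fin.castSucc i)
      = if (m : ℕ) ≤ (i : ℕ) then -u (Fin.castSucc i) else 0 := by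
    intro i
    rw [if_neg (Fin.castSucc_lt_last i).ne]
    by_cases h : (m : ℕ) ≤ (i : ℕ)
    · rw [if_pos h, if_pos (by exact h)]
      ring
    · rw [if_neg h, if_neg (by exact h)]
      ring
  rw [Finset.sum_congr rfl fun i _ => hcs i, ← Finset.sum_filter, Finset.sum_neg_distrib]
  ring

/-- The top coordinate is `s`: `(𝐔 u)_n = u_n` ("u^{(σ,k)}_{σ(n)} = 0"). [cite: Borinsky2020, eq. (CsigmaWeylexplicit) (tropical.tex l.1005–1008)] -/
theorem chamberMatrix_mulVec_last (u : Fin (n + 1) → ℝ) : (𝐔[n] *ᵥ u) (Fin.last n) = u (Fin.last n) := by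
  rw [chamberMatrix_mulVec]
  have h : univ.filter (fun i : Fin n => ((Fin.last n : Fin (n + 1)) : ℕ) ≤ (i : ℕ)) = ∅ := by
    ext i
    simp only [Finset.mem_filter, Finset.mem_univ, true_and, Fin.val_last, Finset.notMem_empty, iff_false, not_le]
    exact i.isLt
  rw [h, Finset.sum_empty, sub_zero]

/-- The gaps are the `τ`'s: `(𝐔 u)_{i+1} − (𝐔 u)_i = u_i`. [cite: Borinsky2020, eq. (CsigmaWeylexplicit) (tropical.tex l.1005–1008)] -/
theorem chamberMatrix_mulVec_succ_sub (u : Fin (n + 1) → ℝ) (i : Fin n) :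
    (𝐔[n] *ᵥ u) i.succ - (𝐔[n] *ᵥ u) (Fin.castSucc i) = u (Fin.castSucc i) := by
  rw [chamberMatrix_mulVec, chamberMatrix_mulVec]
  have hS : univ.filter (fun i' : Fin n => ((Fin.castSucc i : Fin (n + 1)) : ℕ) ≤ (i' : ℕ)) =
      insert i (univ.filter fun i' : Fin n => ((i.succ : Fin (n + 1)) : ℕ) ≤ (i' : ℕ)) := by
    ext i'
    simp only [Finset.mem_filter, Finset.mem_univ, true_and, Finset.mem_insert, Fin.val_succ]
    change (i : ℕ) ≤ (i' : ℕ) ↔ _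
    constructor
    · intro h
      rcases Nat.eq_or_lt_of_le h with h | h
      · exact Or.inl (Fin.ext h).symm
      · exact Or.inr h
    · rintro (rfl | h)
      · exact le_rfl
      · omega
  have hni : i ∉ univ.filter (fun i' : Fin n => ((i.succ : Fin (n + 1)) : ℕ) ≤ (i' : ℕ)) := by
    simp
  rw [hS, Finset.sum_insert hni]
  ring

/-- In the coordinates `(τ, s)`: `(𝐔 (τ, s))_m = s − Σ_{i ≥ m} τ_i` ("y = Σ_k u^{(k)} λ_k", here bordered by `s𝟙`). [cite: Borinsky2020, eq. (CsigmaWeylexplicit) (tropical.tex l.1005–1008); Lemma 17 proof (l.764)] -/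
theorem chamberMatrix_mulVec_snoc (τ : Fin n → ℝ) (s : ℝ) (m : Fin (n + 1)) :
    (𝐔[n] *ᵥ Fin.snoc τ s) m = s - ∑ i ∈ univ.filter (fun i : Fin n => (m : ℕ) ≤ (i : ℕ)), τ i := by
  rw [chamberMatrix_mulVec]
  simp only [Fin.snoc_last, Fin.snoc_castSucc]

/-- `𝐔 (τ, s) = 𝐔 (τ, 0) + s𝟙` — the bordering column is the `𝟙`-direction of `ℝⁿ/𝟙ℝ`. [cite: Borinsky2020, eq. (CsigmaWeyl)–(CsigmaWeylexplicit) (tropical.tex l.1002–1008)] -/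
theorem chamberMatrix_mulVec_snoc_eq_add (τ : Fin n → ℝ) (s : ℝ) :
    𝐔[n] *ᵥ Fin.snoc τ s = fun m => (𝐔[n] *ᵥ Fin.snoc τ 0) m + s := by
  funext m
  rw [chamberMatrix_mulVec_snoc, chamberMatrix_mulVec_snoc]
  ring

/-- `⟨𝐔(τ,s), w⟩ = Σ_i (−Σ_{j ≤ i} w_j) τ_i` when `⟨𝟙, w⟩ = 0` ("e^{−Σ_k λ_k ⟨u^{(k)},w⟩}" with "⟨u^{(σ,k)}, w⟩ = −Σ_{A^σ_k} w"; Abel summation along the chain). [cite: Borinsky2020, Lemma 17 proof (tropical.tex l.762–766); proof of Theorem 27 (l.1093–1094)] -/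
theorem chamberMatrix_mulVec_snoc_dotProduct (τ : Fin n → ℝ) (s : ℝ) (w : Fin (n + 1) → ℝ) (hw : ∑ m, w m = 0) :
    (𝐔[n] *ᵥ Fin.snoc τ s) ⬝ᵥ w =
      ∑ i : Fin n, (-∑ j ∈ univ.filter (fun j : Fin (n + 1) => (j : ℕ) ≤ (i : ℕ)), w j) * τ i := by
  simp only [dotProduct, chamberMatrix_mulVec_snoc, sub_mul, Finset.sum_sub_distrib]
  rw [← Finset.mul_sum, hw, mul_zero, zero_sub]
  simp only [Finset.sum_mul, Finset.sum_filter, neg_mul]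
  rw [← Finset.sum_neg_distrib]
  simp only [← Finset.sum_neg_distrib]
  rw [Finset.sum_comm]
  refine Finset.sum_congr rfl fun i _ => Finset.sum_congr rfl fun j _ => ?_
  split_ifs <;> ring

/-- **`|det(u^{(1)}, …, u^{(n)}, 𝟙)| = 1`** ("From the form of the u^{(σ,k)} vectors … it is obvious that |det(u^{(σ,1)}, …, u^{(σ,n−1)}, 𝟙)| = 1": the bordered matrix is triangular with `∓1` on the diagonal). [cite: Borinsky2020, proof of Theorem 27 (tropical.tex l.1095–1096); Lemma 17 (l.745)] -/
theorem abs_det_chamberMatrix : |Matrix.det 𝐔[n]| = 1 := by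
  rw [Matrix.det_of_upperTriangular]
  · rw [Finset.abs_prod]
    refine Finset.prod_eq_one fun m _ => ?_
    rw [Matrix.of_apply]
    by_cases hm : m = Fin.last n
    · simp [hm]
    · simp [hm]
  · intro i j hij
    have hij' : j < i := hij
    have hj : j ≠ Fin.last n := ne_of_lt (lt_of_lt_of_le hij' (Fin.le_last i))
    have hle : ¬ ((i : ℕ) ≤ (j : ℕ)) := not_le.mpr (Fin.lt_def.mp hij')
    simp only [Matrix.of_apply, if_neg hj, if_neg hle]

/-- Hence `det 𝐔 ≠ 0` (the generators are "linear independent"). [cite: Borinsky2020, Lemma 17 (tropical.tex l.743–745); proof of Theorem 27 (l.1095–1096)] -/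
theorem det_chamberMatrix_ne_zero : Matrix.det 𝐔[n] ≠ 0 := fun h => by
  have h1 := abs_det_chamberMatrix (n := n)
  rw [h, abs_zero] at h1
  exact zero_ne_one h1

/-- … and `𝐔` is invertible. [cite: Borinsky2020, Lemma 17 (tropical.tex l.743–745)] -/
theorem isUnit_chamberMatrix : IsUnit 𝐔[n] :=
  (Matrix.isUnit_iff_isUnit_det _).mpr det_chamberMatrix_ne_zero.isUnit

/-- The image of the gap domain `{τ > 0} × ℝ` under `𝐔` is the OPEN chamber `{y strictly increasing}` ("convenient coordinates describing points in their interior"). [cite: Borinsky2020, §4 before Lemma 17 (tropical.tex l.737–740); eq. (CsigmaWeylexplicit) (l.1005–1008)] -/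
theorem image_chamberMatrix_mulVec :
    (fun u => 𝐔[n] *ᵥ u) '' {u : Fin (n + 1) → ℝ | ∀ i : Fin n, 0 < u (Fin.castSucc i)} =
      {y : Fin (n + 1) → ℝ | StrictMono y} := by
  ext y
  simp only [Set.mem_image, Set.mem_setOf_eq]
  constructor
  · rintro ⟨u, hu, rfl⟩
    refine Fin.strictMono_iff_lt_succ.mpr fun i => ?_
    have := chamberMatrix_mulVec_succ_sub u i
    linarith [hu i]
  · intro hy
    obtain ⟨u, hu⟩ := Matrix.mulVec_surjective_iff_isUnit.mpr (isUnit_chamberMatrix (n := n)) y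
    refine ⟨u, fun i => ?_, hu⟩
    have h := chamberMatrix_mulVec_succ_sub u i
    rw [hu] at h
    rw [← h]
    exact sub_pos.mpr (hy Fin.castSucc_lt_succ)

/-- The closed chamber `C_1 = {y_0 ≤ ⋯ ≤ y_n}` and the open one differ by a Lebesgue-null set (the ties; "other cones … only describe measure zero subsets"). [cite: Borinsky2020, proof of Theorem 19 (tropical.tex l.805–812)] -/
theorem weylChamber_one_ae_eq_strictMono :
    (weylChamber (1 : Equiv.Perm (Fin (n + 1))) : Set (Fin (n + 1) → ℝ)) =ᵐ[volume]
      {y : Fin (n + 1) → ℝ | StrictMono y} := by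
  filter_upwards [ae_injective (μ := (volume : Measure (Fin (n + 1) → ℝ))) Measure.AbsolutelyContinuous.rfl] with y hy
  apply propext
  change y ∈ weylChamber 1 ↔ y ∈ {y : Fin (n + 1) → ℝ | StrictMono y}
  rw [mem_weylChamber_iff_monotone]
  simp only [Equiv.Perm.coe_one, Function.comp_id, Set.mem_setOf_eq]
  exact ⟨fun h => h.strictMono_of_injective hy, fun h => h.monotone⟩

/-- The gap domain `{τ > 0} × ℝ` is measurable. Plumbing. [cite: Borinsky2020, Lemma 17 proof (tropical.tex l.762–766)] -/
theorem measurableSet_gapDomain :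
    MeasurableSet {u : Fin (n + 1) → ℝ | ∀ i : Fin n, 0 < u (Fin.castSucc i)} := by
  have h : {u : Fin (n + 1) → ℝ | ∀ i : Fin n, 0 < u (Fin.castSucc i)} =
      ⋂ i : Fin n, (fun u : Fin (n + 1) → ℝ => u (Fin.castSucc i)) ⁻¹' Ioi 0 := by
    ext u; simp
  rw [h]
  exact MeasurableSet.iInter fun i => measurableSet_Ioi.preimage (measurable_pi_apply _)

/-- **Change of variables onto the standard chamber** ("Using barycentric coordinates y = Σ u^{(k)} λ_k shows that this is equal to |det(…)| ∫ …"): `∫_{C_1} Φ(y) dy = ∫_{τ>0, s∈ℝ} Φ(𝐔(τ,s)) dτ ds`, `|det 𝐔| = 1` (Mathlib's Jacobian theorem). [cite: Borinsky2020, Lemma 17 proof (tropical.tex l.762–766); proof of Theorem 27 (l.1095–1096)] -/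
theorem setIntegral_weylChamber_one_eq_gapDomain (Φ : (Fin (n + 1) → ℝ) → ℝ) :
    ∫ y in weylChamber (1 : Equiv.Perm (Fin (n + 1))), Φ y =
      ∫ u in {u : Fin (n + 1) → ℝ | ∀ i : Fin n, 0 < u (Fin.castSucc i)}, Φ (𝐔[n] *ᵥ u) := by
  rw [setIntegral_congr_set weylChamber_one_ae_eq_strictMono, ← image_chamberMatrix_mulVec]
  have hderiv : ∀ u ∈ {u : Fin (n + 1) → ℝ | ∀ i : Fin n, 0 < u (Fin.castSucc i)},
      HasFDerivWithinAt (fun u => 𝐔[n] *ᵥ u) (coneMap 𝐔[n]) {u | ∀ i : Fin n, 0 < u (Fin.castSucc i)} u := by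
    intro u _
    have h : (fun u : Fin (n + 1) → ℝ => 𝐔[n] *ᵥ u) = coneMap 𝐔[n] := by
      funext u; rw [coneMap_apply]
    rw [h]
    exact (coneMap 𝐔[n]).hasFDerivAt.hasFDerivWithinAt
  have hinj : Set.InjOn (fun u : Fin (n + 1) → ℝ => 𝐔[n] *ᵥ u) {u | ∀ i : Fin n, 0 < u (Fin.castSucc i)} :=
    fun a _ b _ h => (Matrix.mulVec_injective_iff_isUnit.mpr (isUnit_chamberMatrix (n := n))) h
  rw [integral_image_eq_integral_abs_det_fderiv_smul volume measurableSet_gapDomain hderiv hinj]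
  refine setIntegral_congr_fun measurableSet_gapDomain fun u _ => ?_
  rw [det_coneMap, abs_det_chamberMatrix, one_smul]

/-! ### Splitting `u = (τ, s)` and shearing `s` -/

/-- Splitting `u = (τ, s)`: the measurable equivalence `u ↦ (u ∘ castSucc, u_n)` with inverse `(τ, s) ↦ snoc τ s` preserves Lebesgue measure. Plumbing (Mathlib's `volume_preserving_piFinSuccAbove`). [cite: Borinsky2020, Lemma 17 proof (tropical.tex l.762–766)] -/
theorem measurePreserving_snocEquiv :
    MeasurePreserving ((MeasurableEquiv.piFinSuccAbove (fun _ : Fin (n + 1) => ℝ) (Fin.last n)).trans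
      MeasurableEquiv.prodComm) (volume : Measure (Fin (n + 1) → ℝ))
      ((volume : Measure (Fin n → ℝ)).prod (volume : Measure ℝ)) :=
  (volume_preserving_piFinSuccAbove (fun _ : Fin (n + 1) => ℝ) (Fin.last n)).trans
    (Measure.measurePreserving_swap (μ := (volume : Measure ℝ)) (ν := (volume : Measure (Fin n → ℝ))))

/-- The splitting map, evaluated. Plumbing. [cite: Borinsky2020, Lemma 17 proof (tropical.tex l.762–766)] -/
theorem snocEquiv_apply (u : Fin (n + 1) → ℝ) :
    ((MeasurableEquiv.piFinSuccAbove (fun _ : Fin (n + 1) => ℝ) (Fin.last n)).trans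
      MeasurableEquiv.prodComm) u = (fun i : Fin n => u (Fin.castSucc i), u (Fin.last n)) := by
  have h1 : ((MeasurableEquiv.piFinSuccAbove (fun _ : Fin (n + 1) => ℝ) (Fin.last n)).trans
      MeasurableEquiv.prodComm) u = (Fin.removeNth (Fin.last n) u, u (Fin.last n)) := rfl
  rw [h1, Fin.removeNth_last]
  rfl

/-- Its inverse is `(τ, s) ↦ snoc τ s`. Plumbing. [cite: Borinsky2020, Lemma 17 proof (tropical.tex l.762–766)] -/
theorem snocEquiv_symm_apply (p : (Fin n → ℝ) × ℝ) :
    ((MeasurableEquiv.piFinSuccAbove (fun _ : Fin (n + 1) => ℝ) (Fin.last n)).trans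
      MeasurableEquiv.prodComm).symm p = Fin.snoc p.1 p.2 := by
  apply ((MeasurableEquiv.piFinSuccAbove (fun _ : Fin (n + 1) => ℝ) (Fin.last n)).trans
      MeasurableEquiv.prodComm).injective
  rw [MeasurableEquiv.apply_symm_apply, snocEquiv_apply]
  ext <;> simp

/-- `∫_{τ>0, s} Ψ(u) du = ∫_{(τ,s) ∈ ℝⁿ_{>0} × ℝ} Ψ(snoc τ s) d(τ,s)` (Fubini set-up for the `λ`-integral of Lemma 17's proof, here with the extra `𝟙`-coordinate `s`). [cite: Borinsky2020, Lemma 17 proof (tropical.tex l.762–766)] -/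
theorem setIntegral_gapDomain_eq_prod (Ψ : (Fin (n + 1) → ℝ) → ℝ) :
    ∫ u in {u : Fin (n + 1) → ℝ | ∀ i : Fin n, 0 < u (Fin.castSucc i)}, Ψ u =
      ∫ p in orthant n ×ˢ (univ : Set ℝ), Ψ (Fin.snoc p.1 p.2) ∂((volume : Measure (Fin n → ℝ)).prod volume) := by
  set e := (MeasurableEquiv.piFinSuccAbove (fun _ : Fin (n + 1) => ℝ) (Fin.last n)).trans
      (MeasurableEquiv.prodComm (α := ℝ) (β := Fin n → ℝ)) with he
  have hpre : {u : Fin (n + 1) → ℝ | ∀ i : Fin n, 0 < u (Fin.castSucc i)} = e ⁻¹' (orthant n ×ˢ (univ : Set ℝ)) := by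
    ext u
    rw [Set.mem_preimage, he, snocEquiv_apply, Set.mem_prod, mem_orthant]
    simp
  rw [hpre]
  have h := (measurePreserving_snocEquiv (n := n)).setIntegral_preimage_emb e.measurableEmbedding
    (fun p => Ψ (Fin.snoc p.1 p.2)) (orthant n ×ˢ (univ : Set ℝ))
  rw [← he] at h
  have h' : ∀ u, Ψ (Fin.snoc (e u).1 (e u).2) = Ψ u := by
    intro u
    have h2 := snocEquiv_symm_apply (n := n) (e u)
    rw [← he, MeasurableEquiv.symm_apply_apply] at h2
    rw [← h2]
  simp only [h'] at h
  exact h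

/-- **Lemma 17 for the standard chamber, bordered by the `𝟙`-direction**: for `G` invariant under `y ↦ y + c𝟙`, `⟨𝟙,w⟩ = 0`, any `p` and any `h : ℝ → ℝ`, `∫_{C_1} G(y) e^{−⟨y,w⟩} h(y_p) dy = (∫ h) · ∫_{τ>0} G(𝐔(τ,0)) e^{−Σ_i c_i τ_i} dτ` with the rates `c_i = −Σ_{j≤i} w_j = ⟨u^{(i+1)}, w⟩` ("= |det(…)| ∫_{ℝ^{n−1}_{>0}} e^{−Σ_k λ_k⟨u^{(k)},w⟩} f(…) Π dλ_k"; the `s`-integral factors off after the shear `s ↦ s + Σ_{i≥p} τ_i`). [cite: Borinsky2020, Lemma 17 and its proof (tropical.tex l.742–774); proof of Theorem 27 (l.1086–1096)] -/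
theorem setIntegral_weylChamber_one_mul_exp (G : (Fin (n + 1) → ℝ) → ℝ)
    (hG : ∀ (y : Fin (n + 1) → ℝ) (c : ℝ), G (fun m => y m + c) = G y)
    (w : Fin (n + 1) → ℝ) (hw : ∑ m, w m = 0) (p : Fin (n + 1)) (h : ℝ → ℝ) :
    ∫ y in weylChamber (1 : Equiv.Perm (Fin (n + 1))), G y * Real.exp (-(y ⬝ᵥ w)) * h (y p) =
      (∫ s, h s) * ∫ τ in orthant n, G (𝐔[n] *ᵥ Fin.snoc τ 0) *
        Real.exp (-∑ i : Fin n, (-∑ j ∈ univ.filter (fun j : Fin (n + 1) => (j : ℕ) ≤ (i : ℕ)), w j) * τ i) := by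
  rw [setIntegral_weylChamber_one_eq_gapDomain, setIntegral_gapDomain_eq_prod]
  set d : (Fin n → ℝ) → ℝ := fun τ => ∑ i ∈ univ.filter (fun i : Fin n => (p : ℕ) ≤ (i : ℕ)), τ i with hd_def
  set A : (Fin n → ℝ) → ℝ := fun τ => G (𝐔[n] *ᵥ Fin.snoc τ 0) *
    Real.exp (-∑ i : Fin n, (-∑ j ∈ univ.filter (fun j : Fin (n + 1) => (j : ℕ) ≤ (i : ℕ)), w j) * τ i) with hA_def
  have hΦ : ∀ q : (Fin n → ℝ) × ℝ, G (𝐔[n] *ᵥ Fin.snoc q.1 q.2) * Real.exp (-(𝐔[n] *ᵥ Fin.snoc q.1 q.2 ⬝ᵥ w)) *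
      h ((𝐔[n] *ᵥ Fin.snoc q.1 q.2) p) = A q.1 * h (q.2 - d q.1) := by
    rintro ⟨τ, s⟩
    simp only [hA_def, hd_def]
    rw [chamberMatrix_mulVec_snoc_dotProduct τ s w hw, chamberMatrix_mulVec_snoc,
      chamberMatrix_mulVec_snoc_eq_add τ s, hG]
  simp only [hΦ]
  rw [← Measure.restrict_prod_eq_prod_univ]
  have hd : Measurable d := Finset.measurable_sum _ fun i _ => measurable_pi_apply i
  -- the shear `(τ, s) ↦ (τ, s + d τ)` preserves the product measure
  let S : (Fin n → ℝ) × ℝ ≃ᵐ (Fin n → ℝ) × ℝ :=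
    { toFun := fun q => (q.1, q.2 + d q.1)
      invFun := fun q => (q.1, q.2 - d q.1)
      left_inv := fun q => by simp
      right_inv := fun q => by simp
      measurable_toFun := measurable_fst.prodMk (measurable_snd.add (hd.comp measurable_fst))
      measurable_invFun := measurable_fst.prodMk (measurable_snd.sub (hd.comp measurable_fst)) }
  have hS : MeasurePreserving S (((volume : Measure (Fin n → ℝ)).restrict (orthant n)).prod volume)
      (((volume : Measure (Fin n → ℝ)).restrict (orthant n)).prod volume) :=
    MeasurePreserving.skew_product (f := id) (MeasurePreserving.id _) (g := fun τ s => s + d τ)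
      (measurable_snd.add (hd.comp measurable_fst))
      (Filter.Eventually.of_forall fun τ => map_add_right_eq_self volume (d τ))
  have hcomp := hS.integral_comp' (fun q : (Fin n → ℝ) × ℝ => A q.1 * h (q.2 - d q.1))
  have hSq : ∀ q : (Fin n → ℝ) × ℝ, A (S q).1 * h ((S q).2 - d (S q).1) = A q.1 * h q.2 := by
    intro q
    change A q.1 * h (q.2 + d q.1 - d q.1) = A q.1 * h q.2
    rw [add_sub_cancel_right]
  simp only [hSq] at hcomp
  rw [← hcomp, integral_prod_mul, mul_comm]

/-- The same with the gaps sent onto the unit cube by the printed substitution `λ_k = −(1/⟨u^{(k)},w⟩) log ξ_k` (`ConeIntegral.integral_unitCube_comp_logMap`; requires `c_i > 0`): `∫_{C_1} G e^{−⟨y,w⟩} h(y_p) = (∫h) · Π_i c_i⁻¹ · ∫_{[0,1]^n} G(y(ξ)) dξ`, `y(ξ)_m = Σ_{i ≥ m} log ξ_i / c_i` — i.e. `x(ξ)_m = Π_{i≥m} ξ_i^{1/c_i}`, the printed `x_k = Π_i ξ_i^{−u_k^{(i)}/⟨u^{(i)},w⟩}`. [cite: Borinsky2020, Lemma 17 (tropical.tex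 l.742–774); Theorem 27 (l.1063–1085)] -/
theorem setIntegral_weylChamber_one_mul_exp_eq_unitCube (G : (Fin (n + 1) → ℝ) → ℝ)
    (hG : ∀ (y : Fin (n + 1) → ℝ) (c : ℝ), G (fun m => y m + c) = G y)
    (w : Fin (n + 1) → ℝ) (hw : ∑ m, w m = 0)
    (hc : ∀ i : Fin n, 0 < -∑ j ∈ univ.filter (fun j : Fin (n + 1) => (j : ℕ) ≤ (i : ℕ)), w j)
    (p : Fin (n + 1)) (h : ℝ → ℝ) :
    ∫ y in weylChamber (1 : Equiv.Perm (Fin (n + 1))), G y * Real.exp (-(y ⬝ᵥ w)) * h (y p) =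
      (∫ s, h s) * (∏ i : Fin n, 1 / (-∑ j ∈ univ.filter (fun j : Fin (n + 1) => (j : ℕ) ≤ (i : ℕ)), w j)) *
        ∫ ξ in unitCube n, G (fun m => ∑ i ∈ univ.filter (fun i : Fin n => (m : ℕ) ≤ (i : ℕ)),
          Real.log (ξ i) / (-∑ j ∈ univ.filter (fun j : Fin (n + 1) => (j : ℕ) ≤ (i : ℕ)), w j)) := by
  rw [setIntegral_weylChamber_one_mul_exp G hG w hw p h]
  set c : Fin n → ℝ := fun i => -∑ j ∈ univ.filter (fun j : Fin (n + 1) => (j : ℕ) ≤ (i : ℕ)), w j with hc_def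
  have hD := integral_unitCube_comp_logMap c hc (fun l => G (𝐔[n] *ᵥ Fin.snoc l 0))
  have hP : (∏ k, c k) ≠ 0 := Finset.prod_ne_zero_iff.mpr fun k _ => (hc k).ne'
  have hD' : ∫ l in orthant n, G (𝐔[n] *ᵥ Fin.snoc l 0) * Real.exp (-∑ k, c k * l k) =
      (∏ k, 1 / c k) * ∫ ξ in unitCube n, G (𝐔[n] *ᵥ Fin.snoc (logMap c ξ) 0) := by
    rw [hD, ← mul_assoc, Finset.prod_div_distrib, Finset.prod_const_one, one_div, inv_mul_cancel₀ hP, one_mul]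
  rw [hD', ← mul_assoc]
  congr 1
  refine setIntegral_congr_fun measurableSet_unitCube fun ξ _ => ?_
  congr 1
  funext m
  rw [chamberMatrix_mulVec_snoc, zero_sub, ← Finset.sum_neg_distrib]
  refine Finset.sum_congr rfl fun i _ => ?_
  simp only [logMap]
  ring

/-! ### All chambers: relabelling by `σ` -/

/-- Relabelling by `σ`: `∫_{C_σ} Φ(y) dy = ∫_{C_1} Φ(y' ∘ σ⁻¹) dy'`, `y' = y ∘ σ` the coordinates listed along the chain (`HeppSectorCoordinates.permCoords` preserves Lebesgue measure). [cite: Borinsky2020, eq. (CsigmaWeyl) (tropical.tex l.1002–1004); Theorem 27 (l.1063–1085)] -/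
theorem setIntegral_weylChamber_eq_one (σ : Equiv.Perm (Fin (n + 1))) (Φ : (Fin (n + 1) → ℝ) → ℝ) :
    ∫ y in weylChamber σ, Φ y = ∫ y in weylChamber (1 : Equiv.Perm (Fin (n + 1))), Φ (y ∘ ⇑σ.symm) := by
  have hpre : (weylChamber σ : Set (Fin (n + 1) → ℝ)) = (permCoords σ) ⁻¹' (weylChamber 1) := by
    ext y
    rw [Set.mem_preimage, coe_permCoords, mem_weylChamber_iff_monotone, mem_weylChamber_iff_monotone]
    simp
  rw [hpre]
  have h := (measurePreserving_permCoords σ).setIntegral_preimage_emb (permCoords σ).measurableEmbedding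
    (fun y' => Φ (y' ∘ ⇑σ.symm)) (weylChamber 1)
  have h' : ∀ y : Fin (n + 1) → ℝ, Φ ((permCoords σ y) ∘ ⇑σ.symm) = Φ y := by
    intro y
    rw [coe_permCoords]
    congr 1
    funext m
    simp
  simp only [h'] at h
  exact h

/-- `Σ_{j ≤ i} w_{σ(j)} = Σ_{m ∈ A^σ_{i+1}} w_m` (the chain sets in position coordinates). Plumbing. [cite: Borinsky2020, Theorem 27 (tropical.tex l.1075: A^σ_k = {σ(1), …, σ(k)})] -/
theorem sum_filter_le_apply_perm (σ : Equiv.Perm (Fin (n + 1))) (w : Fin (n + 1) → ℝ) (i : Fin n) :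
    ∑ j ∈ univ.filter (fun j : Fin (n + 1) => (j : ℕ) ≤ (i : ℕ)), w (σ j) = ∑ m ∈ chainSet σ ((i : ℕ) + 1), w m := by
  refine Finset.sum_equiv σ (fun j => ?_) (fun j _ => rfl)
  simp only [Finset.mem_filter, Finset.mem_univ, true_and, apply_mem_chainSet]
  omega

/-- **The sector value `I_σ`, all `σ` (Lemma 17 on the Weyl chamber `C_σ`)**: for `G` invariant under `y ↦ y + c𝟙`, `⟨𝟙,w⟩ = 0`, positive chain-set rates `c_i = −Σ_{m ∈ A^σ_{i+1}} w_m` and any `h`, `∫_{C_σ} G(y) e^{−⟨y,w⟩} h(y_n) dy = (∫ h) · Π_i c_i⁻¹ · ∫_{[0,1]^n} G(log x^{(σ)}(ξ)) dξ` with `log x^{(σ)}(ξ)_m = Σ_{i ≥ σ⁻¹(m)} log ξ_i / c_i` — for `w = w^{(σ,z_ℬ)} − w^{(σ,z_𝒜)}` the rates are `r(A^σ_{i+1})` and this is `(∫h) · I^tr_{C_σ} · ∫_{[0,1]^{n}} G(log x^{(σ)}(ξ)) dξ`. [cite: Borinsky2020, Theorem 27 and its proof (tropical.tex l.1063–1096);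 Lemma 17 (l.742–774); eq. (40) (l.1102–1106)] -/
theorem setIntegral_weylChamber_mul_exp_eq_unitCube (σ : Equiv.Perm (Fin (n + 1))) (G : (Fin (n + 1) → ℝ) → ℝ)
    (hG : ∀ (y : Fin (n + 1) → ℝ) (c : ℝ), G (fun m => y m + c) = G y)
    (w : Fin (n + 1) → ℝ) (hw : ∑ m, w m = 0)
    (hc : ∀ i : Fin n, 0 < -∑ m ∈ chainSet σ ((i : ℕ) + 1), w m) (h : ℝ → ℝ) :
    ∫ y in weylChamber σ, G y * Real.exp (-(y ⬝ᵥ w)) * h (y (Fin.last n)) =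
      (∫ s, h s) * (∏ i : Fin n, 1 / (-∑ m ∈ chainSet σ ((i : ℕ) + 1), w m)) *
        ∫ ξ in unitCube n, G (fun m => ∑ i ∈ univ.filter (fun i : Fin n => ((σ.symm m : Fin (n + 1)) : ℕ) ≤ (i : ℕ)),
          Real.log (ξ i) / (-∑ m' ∈ chainSet σ ((i : ℕ) + 1), w m')) := by
  rw [setIntegral_weylChamber_eq_one]
  have hG' : ∀ (y : Fin (n + 1) → ℝ) (c : ℝ), G ((fun m => y m + c) ∘ ⇑σ.symm) = G (y ∘ ⇑σ.symm) :=
    fun y c => hG (y ∘ ⇑σ.symm) c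
  have hw' : ∑ j, (w ∘ ⇑σ) j = 0 := by
    simp only [Function.comp_apply]
    rw [Equiv.sum_comp σ w, hw]
  have hdot : ∀ y : Fin (n + 1) → ℝ, (y ∘ ⇑σ.symm) ⬝ᵥ w = y ⬝ᵥ (w ∘ ⇑σ) := by
    intro y
    simp only [dotProduct, Function.comp_apply]
    rw [← Equiv.sum_comp σ (fun m => y (σ.symm m) * w m)]
    simp
  have hc' : ∀ i : Fin n, 0 < -∑ j ∈ univ.filter (fun j : Fin (n + 1) => (j : ℕ) ≤ (i : ℕ)), (w ∘ ⇑σ) j := by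
    intro i
    simp only [Function.comp_apply]
    rw [sum_filter_le_apply_perm]
    exact hc i
  have key := setIntegral_weylChamber_one_mul_exp_eq_unitCube (fun y => G (y ∘ ⇑σ.symm)) hG' (w ∘ ⇑σ) hw' hc'
    (σ.symm (Fin.last n)) h
  have lhs_eq : (fun y : Fin (n + 1) → ℝ => G (y ∘ ⇑σ.symm) * Real.exp (-((y ∘ ⇑σ.symm) ⬝ᵥ w)) *
      h ((y ∘ ⇑σ.symm) (Fin.last n))) =
      fun y => G (y ∘ ⇑σ.symm) * Real.exp (-(y ⬝ᵥ (w ∘ ⇑σ))) * h (y (σ.symm (Fin.last n))) := by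
    funext y
    rw [hdot]
    rfl
  rw [lhs_eq, key]
  simp only [Function.comp_apply, sum_filter_le_apply_perm]
  rfl

/-! ### The chart `x_n = 1` as an average over the `𝟙`-direction -/

/-- **The affine chart `x_n = 1` as an average over the `𝟙`-direction**: for `H` invariant under `y ↦ y + c𝟙` (a function on `ℝ^{n+1}/𝟙ℝ`) and any `h : ℝ → ℝ`, `∫_{ℝ^{n+1}} H(ỹ) h(ỹ_n) dỹ = (∫ h) · ∫_{ℝⁿ} H(y, 0) dy` — the substitution `ỹ = (y, 0) + s𝟙` (a shear followed by `snoc`, both measure preserving). This is how the integral "over ℙ^{n−1}_{>0} or (equivalently over ℝⁿ/𝟙ℝ)" in the chart of eq. (integral_euler_mellin) is handed to the sector decomposition of `ℝ^{n+1}`. [cite: Borinsky2020, eq. (integral_euler_mellin) (tropical.tex l.237–245); proof of Theorem 19 (l.805–810)] -/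
theorem integral_mul_apply_last_eq (H : (Fin (n + 1) → ℝ) → ℝ)
    (hH : ∀ (y : Fin (n + 1) → ℝ) (c : ℝ), H (fun m => y m + c) = H y) (h : ℝ → ℝ) :
    ∫ y, H y * h (y (Fin.last n)) = (∫ s, h s) * ∫ y : Fin n → ℝ, H (Fin.snoc y 0) := by
  set e := MeasurableEquiv.piFinSuccAbove (fun _ : Fin (n + 1) => ℝ) (Fin.last n) with he
  have hes : MeasurePreserving e.symm ((volume : Measure ℝ).prod (volume : Measure (Fin n → ℝ))) volume :=
    (volume_preserving_piFinSuccAbove (fun _ : Fin (n + 1) => ℝ) (Fin.last n)).symm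
  have hesymm : ∀ q : ℝ × (Fin n → ℝ), e.symm q = Fin.snoc q.2 q.1 := by
    intro q
    rw [he, MeasurableEquiv.piFinSuccAbove_symm_apply]
    funext j
    rw [Fin.insertNthEquiv_apply, Fin.insertNth_last']
  let S : ℝ × (Fin n → ℝ) ≃ᵐ ℝ × (Fin n → ℝ) :=
    { toFun := fun q => (q.1, fun j => q.2 j + q.1)
      invFun := fun q => (q.1, fun j => q.2 j - q.1)
      left_inv := fun q => by ext <;> simp
      right_inv := fun q => by ext <;> simp
      measurable_toFun := measurable_fst.prodMk
        (measurable_pi_lambda _ fun j => ((measurable_pi_apply j).comp measurable_snd).add measurable_fst)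
      measurable_invFun := measurable_fst.prodMk
        (measurable_pi_lambda _ fun j => ((measurable_pi_apply j).comp measurable_snd).sub measurable_fst) }
  have hS : MeasurePreserving S ((volume : Measure ℝ).prod (volume : Measure (Fin n → ℝ)))
      ((volume : Measure ℝ).prod (volume : Measure (Fin n → ℝ))) := by
    refine MeasurePreserving.skew_product (f := id) (MeasurePreserving.id _)
      (g := fun (s : ℝ) (y : Fin n → ℝ) => fun j => y j + s) ?_ (Filter.Eventually.of_forall fun s => ?_)
    · exact measurable_pi_lambda _ fun j => ((measurable_pi_apply j).comp measurable_snd).add measurable_fst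
    · have : (fun y : Fin n → ℝ => fun j => y j + s) = fun y => y + fun _ => s := by
        funext y; rfl
      rw [this]
      exact map_add_right_eq_self volume _
  have h1 := hes.integral_comp' (fun y => H y * h (y (Fin.last n)))
  have h2 := hS.integral_comp' (fun q => H (e.symm q) * h ((e.symm q) (Fin.last n)))
  rw [← h1, ← h2]
  have h3 : ∀ q : ℝ × (Fin n → ℝ), H (e.symm (S q)) * h ((e.symm (S q)) (Fin.last n)) = h q.1 * H (Fin.snoc q.2 0) := by
    intro q
    rw [hesymm]
    change H (Fin.snoc (fun j => q.2 j + q.1) q.1) * h (Fin.snoc (α := fun _ => ℝ) (fun j => q.2 j + q.1) q.1 (Fin.last n)) = _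
    rw [Fin.snoc_last]
    have hsn : Fin.snoc (α := fun _ => ℝ) (fun j => q.2 j + q.1) q.1 = fun m => Fin.snoc (α := fun _ => ℝ) q.2 0 m + q.1 := by
      funext m
      refine Fin.lastCases ?_ (fun j => ?_) m
      · simp
      · simp
    rw [hsn, hH, mul_comm]
  simp only [h3]
  exact integral_prod_mul (μ := (volume : Measure ℝ)) (ν := (volume : Measure (Fin n → ℝ))) h
    (fun y => H (Fin.snoc y 0))

/-- … and `ỹ ↦ H(ỹ) h(ỹ_n)` is integrable on `ℝ^{n+1}` as soon as `y ↦ H(y, 0)` is integrable on `ℝⁿ` and `h` on `ℝ` (same substitution). [cite: Borinsky2020, eq. (integral_euler_mellin) (tropical.tex l.237–245); proof of Theorem 19 (l.805–810)] -/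
theorem integrable_mul_apply_last (H : (Fin (n + 1) → ℝ) → ℝ)
    (hH : ∀ (y : Fin (n + 1) → ℝ) (c : ℝ), H (fun m => y m + c) = H y) {h : ℝ → ℝ} (hh : Integrable h)
    (hH0 : Integrable (fun y : Fin n → ℝ => H (Fin.snoc y 0))) :
    Integrable (fun y : Fin (n + 1) → ℝ => H y * h (y (Fin.last n))) := by
  set e := MeasurableEquiv.piFinSuccAbove (fun _ : Fin (n + 1) => ℝ) (Fin.last n) with he
  have hes : MeasurePreserving e.symm ((volume : Measure ℝ).prod (volume : Measure (Fin n → ℝ))) volume :=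
    (volume_preserving_piFinSuccAbove (fun _ : Fin (n + 1) => ℝ) (Fin.last n)).symm
  have hesymm : ∀ q : ℝ × (Fin n → ℝ), e.symm q = Fin.snoc q.2 q.1 := by
    intro q
    rw [he, MeasurableEquiv.piFinSuccAbove_symm_apply]
    funext j
    rw [Fin.insertNthEquiv_apply, Fin.insertNth_last']
  let S : ℝ × (Fin n → ℝ) ≃ᵐ ℝ × (Fin n → ℝ) :=
    { toFun := fun q => (q.1, fun j => q.2 j + q.1)
      invFun := fun q => (q.1, fun j => q.2 j - q.1)
      left_inv := fun q => by ext <;> simp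
      right_inv := fun q => by ext <;> simp
      measurable_toFun := measurable_fst.prodMk
        (measurable_pi_lambda _ fun j => ((measurable_pi_apply j).comp measurable_snd).add measurable_fst)
      measurable_invFun := measurable_fst.prodMk
        (measurable_pi_lambda _ fun j => ((measurable_pi_apply j).comp measurable_snd).sub measurable_fst) }
  have hS : MeasurePreserving S ((volume : Measure ℝ).prod (volume : Measure (Fin n → ℝ)))
      ((volume : Measure ℝ).prod (volume : Measure (Fin n → ℝ))) := by
    refine MeasurePreserving.skew_product (f := id) (MeasurePreserving.id _)
      (g := fun (s : ℝ) (y : Fin n → ℝ) => fun j => y j + s) ?_ (Filter.Eventually.of_forall fun s => ?_)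
    · exact measurable_pi_lambda _ fun j => ((measurable_pi_apply j).comp measurable_snd).add measurable_fst
    · have : (fun y : Fin n → ℝ => fun j => y j + s) = fun y => y + fun _ => s := by
        funext y; rfl
      rw [this]
      exact map_add_right_eq_self volume _
  rw [← hes.integrable_comp_emb e.symm.measurableEmbedding, ← hS.integrable_comp_emb S.measurableEmbedding]
  have h3 : ((fun y : Fin (n + 1) → ℝ => H y * h (y (Fin.last n))) ∘ e.symm) ∘ S =
      fun q : ℝ × (Fin n → ℝ) => h q.1 * H (Fin.snoc q.2 0) := by
    funext q
    simp only [Function.comp_apply]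
    rw [hesymm]
    change H (Fin.snoc (fun j => q.2 j + q.1) q.1) * h (Fin.snoc (α := fun _ => ℝ) (fun j => q.2 j + q.1) q.1 (Fin.last n)) = _
    rw [Fin.snoc_last]
    have hsn : Fin.snoc (α := fun _ => ℝ) (fun j => q.2 j + q.1) q.1 = fun m => Fin.snoc (α := fun _ => ℝ) q.2 0 m + q.1 := by
      funext m
      refine Fin.lastCases ?_ (fun j => ?_) m
      · simp
      · simp
    rw [hsn, hH, mul_comm]
  rw [h3]
  exact hh.mul_prod hH0

end ChamberParametrisation

section RemovalSequences

open Finset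

variable {n : ℕ}

/-! ### Permutations as Algorithm 4's removal sequences: `σ ↦ (σ(n), σ(n−1), …, σ(0))` -/

/-- The removal sequence of `σ` — the list `(σ(n), …, σ(1), σ(0))` ("Set σ(|A|) = e" for the element removed first) — is an ordering of `[n]` in the sense of `SectorTableRecursion.orderings`. [cite: Borinsky2020, §6.2 Algorithm 4 (tropical.tex l.1126–1144); proof of Proposition 29 (l.1117–1121)] -/
theorem reverse_ofFn_mem_orderings (σ : Equiv.Perm (Fin (n + 1))) :
    (List.ofFn ⇑σ).reverse ∈ orderings (univ : Finset (Fin (n + 1))) := by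
  rw [mem_orderings]
  refine ⟨List.nodup_reverse.mpr ((List.nodup_ofFn (f := ⇑σ)).mpr σ.injective), ?_⟩
  ext m
  simp only [List.toFinset_reverse, List.mem_toFinset, List.mem_ofFn, mem_univ, iff_true]
  exact ⟨σ.symm m, σ.apply_symm_apply m⟩

/-- Along the removal sequence of `σ` the successive tails have element sets `A^σ_n ⊋ ⋯ ⊋ A^σ_1 ⊋ ∅`, so its weight `Π 1/r(tail)` is `Π_{k=0}^{n} 1/r(A^σ_k)` — with the printed convention `r(∅) = 1` this is `Π_{k=1}^{n} 1/r(A^σ_k) = I^tr_{C_σ}` of eq. (40). [cite: Borinsky2020, eq. (40) (tropical.tex l.1102–1106); proof of Proposition 29 (l.1117–1121)] -/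
theorem orderingWeight_reverse_ofFn (r : Finset (Fin (n + 1)) → ℝ) (hr0 : r ∅ = 1) (σ : Equiv.Perm (Fin (n + 1))) :
    orderingWeight r (List.ofFn ⇑σ).reverse = ∏ i : Fin n, (r (chainSet σ ((i : ℕ) + 1)))⁻¹ := by
  -- the truncated removal sequences `L k = (σ(k−1), …, σ(0))`
  set σ' : ℕ → Fin (n + 1) := fun j => if h : j < n + 1 then σ ⟨j, h⟩ else σ 0 with hσ'
  have key : ∀ k, k ≤ n + 1 →
      (List.ofFn fun j : Fin k => σ' j).reverse.toFinset = chainSet σ k ∧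
        orderingWeight r (List.ofFn fun j : Fin k => σ' j).reverse = ∏ j ∈ range k, (r (chainSet σ j))⁻¹ := by
    intro k
    induction k with
    | zero =>
      intro _
      simp [chainSet_zero]
    | succ k ih =>
      intro hk
      obtain ⟨ih1, ih2⟩ := ih (Nat.le_of_succ_le hk)
      have hk' : k < n + 1 := hk
      have hL : (List.ofFn fun j : Fin (k + 1) => σ' j).reverse = σ' k :: (List.ofFn fun j : Fin k => σ' j).reverse := by
        rw [List.ofFn_succ', List.concat_eq_append, List.reverse_append]
        simp
      have hσk : σ' k = σ ⟨k, hk'⟩ := by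
        simp only [hσ']
        rw [dif_pos hk']
      refine ⟨?_, ?_⟩
      · rw [hL, List.toFinset_cons, ih1, hσk, chainSet_succ σ hk']
      · rw [hL, orderingWeight_cons, ih2, ih1, Finset.prod_range_succ, div_eq_mul_inv]
  have hfull : (List.ofFn fun j : Fin (n + 1) => σ' j) = List.ofFn ⇑σ := by
    congr 1
    funext j
    simp only [hσ']
    rw [dif_pos j.isLt]
  obtain ⟨-, h2⟩ := key (n + 1) le_rfl
  rw [hfull] at h2
  rw [h2, Finset.prod_range_succ', chainSet_zero, hr0, inv_one, mul_one, ← Fin.prod_univ_eq_prod_range]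

/-- Summing over Algorithm 4's removal sequences of `[n]` is summing over the permutations `σ ∈ S_{n+1}` ("the sum is over all bijections σ : [m] → A"; "The sum can be written as a sum over all permutations in σ ∈ S_n and A_k = A^σ_k"). [cite: Borinsky2020, proof of Proposition 29 (tropical.tex l.1117–1121); proof of Proposition 31 (l.1155)] -/
theorem sum_orderings_univ_eq_sum_perm (φ : List (Fin (n + 1)) → ℝ) :
    ∑ l ∈ orderings (univ : Finset (Fin (n + 1))), φ l = ∑ σ : Equiv.Perm (Fin (n + 1)), φ (List.ofFn ⇑σ).reverse := by
  symm
  -- length of an ordering of `univ`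
  have hlen : ∀ l ∈ orderings (univ : Finset (Fin (n + 1))), l.length = n + 1 := by
    intro l hl
    obtain ⟨hnd, hl⟩ := mem_orderings.mp hl
    rw [← List.toFinset_card_of_nodup hnd, hl, Finset.card_univ, Fintype.card_fin]
  -- the permutation read off an ordering: `σ(k) = l.reverse[k]`
  have hidx : ∀ l ∈ orderings (univ : Finset (Fin (n + 1))), ∀ k : Fin (n + 1), (k : ℕ) < l.reverse.length := by
    intro l hl k
    rw [List.length_reverse, hlen l hl]
    exact k.isLt
  have hinj : ∀ l (hl : l ∈ orderings (univ : Finset (Fin (n + 1)))),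
      Function.Injective fun k : Fin (n + 1) => l.reverse[(k : ℕ)]'(hidx l hl k) := by
    intro l hl a b hab
    obtain ⟨hnd, -⟩ := mem_orderings.mp hl
    have hnd' : l.reverse.Nodup := List.nodup_reverse.mpr hnd
    have := (List.Nodup.getElem_inj_iff hnd').mp hab
    exact Fin.ext this
  refine Finset.sum_bij' (fun σ _ => (List.ofFn ⇑σ).reverse)
    (fun l hl => Equiv.ofBijective (fun k : Fin (n + 1) => l.reverse[(k : ℕ)]'(hidx l hl k))
      (Finite.injective_iff_bijective.mp (hinj l hl)))
    (fun σ _ => reverse_ofFn_mem_orderings σ) (fun l hl => mem_univ _) ?_ ?_ (fun σ _ => rfl)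
  · -- left inverse: reading `(σ(n), …, σ(0))` back gives `σ`
    intro σ _
    refine Equiv.ext fun k => ?_
    simp only [Equiv.ofBijective_apply, List.reverse_reverse, List.getElem_ofFn, Fin.eta]
  · -- right inverse
    intro l hl
    rw [← List.reverse_inj, List.reverse_reverse]
    apply List.ext_getElem
    · rw [List.length_ofFn, List.length_reverse, hlen l hl]
    · intro i h1 h2
      rw [List.getElem_ofFn, Equiv.ofBijective_apply]

/-- **Eq. (40) summed over `S_{n+1}` equals the table value: `Σ_σ Π_{k=1}^{n} 1/r(A^σ_k) = J_r([n])`** for any `r` with `r(∅) = 1` (the identity of Proposition 29's proof, read through the bijection with removal sequences). [cite: Borinsky2020, Proposition 29 and its proof (tropical.tex l.1112–1122); Definition 28 (l.1107–1111)] -/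
theorem sum_perm_prod_inv_eq_sectorTable (r : Finset (Fin (n + 1)) → ℝ) (hr0 : r ∅ = 1) :
    ∑ σ : Equiv.Perm (Fin (n + 1)), ∏ i : Fin n, (r (chainSet σ ((i : ℕ) + 1)))⁻¹ =
      sectorTable r (univ : Finset (Fin (n + 1))) := by
  rw [sectorTable_eq_sum_orderingWeight, sum_orderings_univ_eq_sum_perm]
  exact Finset.sum_congr rfl fun σ _ => (orderingWeight_reverse_ofFn r hr0 σ).symm

/-- **Algorithm 4's sector probability** (the telescoping in the proof of Proposition 31): the run removing `σ(n), …, σ(0)` in this order has probability `I^tr_{C_σ}/J_r([n]) = (Π_{k=1}^{n} 1/r(A^σ_k))/J_r([n])`. [cite: Borinsky2020, Algorithm 4 (tropical.tex l.1126–1144); proof of Proposition 31 (l.1150–1156)] -/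
theorem runProb_reverse_ofFn (r : Finset (Fin (n + 1)) → ℝ) (hr0 : r ∅ = 1)
    (hr : ∀ B : Finset (Fin (n + 1)), B ⊂ univ → 0 < r B) (σ : Equiv.Perm (Fin (n + 1))) :
    runProb r univ (List.ofFn ⇑σ).reverse =
      (∏ i : Fin n, (r (chainSet σ ((i : ℕ) + 1)))⁻¹) / sectorTable r (univ : Finset (Fin (n + 1))) := by
  rw [runProb_eq r hr (reverse_ofFn_mem_orderings σ), orderingWeight_reverse_ofFn r hr0]

end RemovalSequences

section GeneralizedPermutahedra

open MeasureTheory Real Finset Matrix MvPolynomial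

open scoped Pointwise

variable {n : ℕ} {ι κ : Type*} [Fintype ι] [Fintype κ]
  {a : ι → MvPolynomial (Fin (n + 1)) ℝ} {b : κ → MvPolynomial (Fin (n + 1)) ℝ} {ν : ι → ℝ} {ρ : κ → ℝ}
  {zA zB : Finset (Fin (n + 1)) → ℝ}

/-! ### Generalized permutahedra: the exponent vector `w_σ = w^{(σ,z_ℬ)} − w^{(σ,z_𝒜)}` on the chamber `C_σ` -/

/-- `⟨𝟙, w_σ⟩ = z_ℬ([n]) − z_𝒜([n]) = 0` for `w_σ = w^{(σ,z_ℬ)} − w^{(σ,z_𝒜)}` (eq. (homogeneous): 𝒜 and ℬ lie in one hyperplane `⟨𝟙, v⟩ = const`). [cite: Borinsky2020, eq. (homogeneous) (tropical.tex l.229–233), Remark 4 (l.333–337); Lemma 26 eq. (41) (l.1047–1051)] -/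
theorem sum_ftVertex_sub_eq_zero (h0A : zA ∅ = 0) (h0B : zB ∅ = 0) (htop : zA univ = zB univ)
    (σ : Equiv.Perm (Fin (n + 1))) : ∑ m, (ftVertex zB σ - ftVertex zA σ) m = 0 := by
  simp only [Pi.sub_apply, Finset.sum_sub_distrib, sum_univ_ftVertex zB σ h0B, sum_univ_ftVertex zA σ h0A, htop, sub_self]

/-- The chain-set rates of `w_σ`: `−Σ_{m ∈ A^σ_{i+1}} (w_σ)_m = z_𝒜(A^σ_{i+1}) − z_ℬ(A^σ_{i+1}) = r(A^σ_{i+1})` ("⟨u^{(σ,k)}, w^{(σ,z_ℬ)}⟩ − ⟨u^{(σ,k)}, w^{(σ,z_𝒜)}⟩ = z_𝒜(A^σ_k) − z_ℬ(A^σ_k)"). [cite: Borinsky2020, proof of Theorem 27 (tropical.tex l.1093–1094); eq. (40) (l.1102–1106)] -/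
theorem neg_sum_chainSet_ftVertex_sub (h0A : zA ∅ = 0) (h0B : zB ∅ = 0) (σ : Equiv.Perm (Fin (n + 1))) (i : Fin n) :
    -∑ m ∈ chainSet σ ((i : ℕ) + 1), (ftVertex zB σ - ftVertex zA σ) m =
      zA (chainSet σ ((i : ℕ) + 1)) - zB (chainSet σ ((i : ℕ) + 1)) := by
  rw [sum_chainSet_ftVertex_sub h0A h0B σ (by omega : (i : ℕ) + 1 ≤ n + 1), neg_neg]

/-- The chain sets `A^σ_1, …, A^σ_n` are non-empty … [cite: Borinsky2020, Theorem 27 (tropical.tex l.1075–1077)] -/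
theorem chainSet_succ_nonempty (σ : Equiv.Perm (Fin (n + 1))) (i : Fin n) :
    (chainSet σ ((i : ℕ) + 1)).Nonempty :=
  ⟨σ ⟨0, by omega⟩, apply_mem_chainSet.mpr (by simp)⟩

/-- … proper subsets of `[n]`. [cite: Borinsky2020, Theorem 27 (tropical.tex l.1075–1077)] -/
theorem chainSet_succ_ne_univ (σ : Equiv.Perm (Fin (n + 1))) (i : Fin n) :
    chainSet σ ((i : ℕ) + 1) ≠ univ := by
  intro h
  have hmem : σ ⟨(i : ℕ) + 1, by omega⟩ ∈ chainSet σ ((i : ℕ) + 1) := by rw [h]; exact mem_univ _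
  exact apply_not_mem_chainSet σ (by omega : (i : ℕ) + 1 < n + 1) hmem

/-- `r(A^σ_k) > 0`, `k = 1, …, n`, under "r(A) > 0 for all non-empty proper subsets A ⊊ [n]". [cite: Borinsky2020, Theorem 27 (tropical.tex l.1075–1077)] -/
theorem chainSet_rate_pos (hr : ∀ A : Finset (Fin (n + 1)), A.Nonempty → A ≠ univ → zB A < zA A)
    (σ : Equiv.Perm (Fin (n + 1))) (i : Fin n) :
    0 < zA (chainSet σ ((i : ℕ) + 1)) - zB (chainSet σ ((i : ℕ) + 1)) :=
  sub_pos.mpr (hr _ (chainSet_succ_nonempty σ i) (chainSet_succ_ne_univ σ i))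

/-- A positive lower bound `ε ≤ r(A)` over the non-empty proper subsets exists (their minimum; `1` if `n = 0` and there are none). [cite: Borinsky2020, Theorem 27 (tropical.tex l.1075–1077); Lemma 15 (l.669–676)] -/
theorem exists_pos_le_rate (hr : ∀ A : Finset (Fin (n + 1)), A.Nonempty → A ≠ univ → zB A < zA A) :
    ∃ ε : ℝ, 0 < ε ∧ ∀ A : Finset (Fin (n + 1)), A.Nonempty → A ≠ univ → ε ≤ zA A - zB A := by
  classical
  set R := (univ : Finset (Finset (Fin (n + 1)))).filter (fun A => A.Nonempty ∧ A ≠ univ) with hR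
  by_cases hRne : R.Nonempty
  · refine ⟨R.inf' hRne (fun A => zA A - zB A), ?_, ?_⟩
    · refine (Finset.lt_inf'_iff hRne).mpr fun A hA => ?_
      simp only [hR, Finset.mem_filter, Finset.mem_univ, true_and] at hA
      exact sub_pos.mpr (hr A hA.1 hA.2)
    · intro A hA1 hA2
      exact Finset.inf'_le _ (by simp [hR, hA1, hA2])
  · refine ⟨1, one_pos, fun A hA1 hA2 => ?_⟩
    exact absurd ⟨A, by simp [hR, hA1, hA2]⟩ hRne

/-- The chamber `C_σ` is invariant under `y ↦ y + c𝟙` (it is a cone of `ℝⁿ/𝟙ℝ`). [cite: Borinsky2020, eq. (CsigmaWeyl) (tropical.tex l.1002–1004)] -/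
theorem add_const_mem_weylChamber {σ : Equiv.Perm (Fin (n + 1))} {y : Fin (n + 1) → ℝ} (hy : y ∈ weylChamber σ) (c : ℝ) :
    (fun m => y m + c) ∈ weylChamber σ :=
  fun j j' hjj' => by simpa using hy j j' hjj'

/-- **Lemma 15's gap in the generalized-permutahedron case, by Abel summation on each chamber**: if `ε ≤ r(A) = z_𝒜(A) − z_ℬ(A)` on the non-empty proper subsets and `z_𝒜([n]) = z_ℬ([n])`, then `ε (y_k − y_{k'}) ≤ max_ℬ⟨y,·⟩ − max_𝒜⟨y,·⟩` for all `y, k, k'` — on `C_σ` the right-hand side is `⟨y, w_σ⟩ = Σ_{k=1}^{n} (y_{σ(k)} − y_{σ(k−1)}) r(A^σ_k) ≥ ε (max y − min y)`. (The print assumes R1 ∧ R2 and derives `r > 0`; this is the converse direction that lets every `…_of_gap` theorem of `ConvergenceTheorem.lean` run on `r > 0` alone.) [cite: Borinsky2020, Lemma 15 (tropical.tex l.669–676); proof of Theorem 27 (l.1086–1094); Lemma 26 (l.1047–1057)] -/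
theorem gap_of_gp (ha : ∀ i, a i ≠ 0) (hb : ∀ j, b j ≠ 0) (hν : ∀ i, 0 ≤ ν i) (hρ : ∀ j, 0 ≤ ρ j)
    (hzA : Supermodular zA) (hzB : Supermodular zB) (h0A : zA ∅ = 0) (h0B : zB ∅ = 0)
    (hA : (∑ i, ν i • NP⟦a i⟧) = gpPolytope zA) (hB : (∑ j, ρ j • NP⟦b j⟧) = gpPolytope zB)
    (htop : zA univ = zB univ) {ε : ℝ} (hε : 0 ≤ ε)
    (hεr : ∀ A : Finset (Fin (n + 1)), A.Nonempty → A ≠ univ → ε ≤ zA A - zB A)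
    (y : Fin (n + 1) → ℝ) (k k' : Fin (n + 1)) :
    ε * (y k - y k') ≤ (∑ j, ρ j * faceValue (b j) y) - ∑ i, ν i * faceValue (a i) y := by
  set σ := Tuple.sort y with hσdef
  have hy : y ∈ weylChamber σ := mem_weylChamber_sort y
  rw [sum_faceValue_eq_dotProduct_ftVertex a ha hν hzA h0A hA hy, sum_faceValue_eq_dotProduct_ftVertex b hb hρ hzB h0B hB hy,
    ← dotProduct_sub]
  set w : Fin (n + 1) → ℝ := ftVertex zB σ - ftVertex zA σ with hw
  -- Abel summation along the chain
  set Y : ℕ → ℝ := alongChain σ y with hY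
  set W : ℕ → ℝ := alongChain σ w with hW
  set V : ℕ → ℝ := fun m => (if m = n then ε else 0) - (if m = 0 then ε else 0) with hV
  have hdot : y ⬝ᵥ w = ∑ m ∈ range (n + 1), Y m * W m := by
    simp only [dotProduct, hY, hW]
    rw [sum_univ_eq_sum_range σ (fun m => y m * w m)]
    exact Finset.sum_congr rfl fun m _ => alongChain_mul σ y w m
  have hYmono : ∀ m, m + 1 < n + 1 → Y m ≤ Y (m + 1) := by
    intro m hm
    simp only [hY]
    rw [alongChain_of_lt σ y (by omega : m < n + 1), alongChain_of_lt σ y hm]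
    exact hy ⟨m, by omega⟩ ⟨m + 1, hm⟩ (by simp)
  have hsumV : ∀ k ≤ n + 1, ∑ m ∈ range k, V m = (if n < k then ε else 0) - (if 0 < k then ε else 0) := by
    intro k _
    simp only [hV, Finset.sum_sub_distrib, Finset.sum_ite_eq', Finset.mem_range]
  have hsumW : ∀ k ≤ n + 1, ∑ m ∈ range k, W m = ∑ i ∈ chainSet σ k, w i := by
    intro k hk
    rw [hW, sum_chainSet_eq_sum_range σ w hk]
  have hVW : ∑ m ∈ range (n + 1), V m = ∑ m ∈ range (n + 1), W m := by
    rw [hsumV _ le_rfl, hsumW _ le_rfl, chainSet_of_le σ le_rfl, hw, sum_ftVertex_sub_eq_zero h0A h0B htop σ]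
    simp
  have hpart : ∀ k ≤ n + 1, ∑ m ∈ range k, W m ≤ ∑ m ∈ range k, V m := by
    intro k hk
    rw [hsumV k hk, hsumW k hk]
    rcases Nat.eq_zero_or_pos k with rfl | hk0
    · simp [chainSet_zero]
    rcases eq_or_lt_of_le hk with rfl | hklt
    · rw [chainSet_of_le σ le_rfl, hw, sum_ftVertex_sub_eq_zero h0A h0B htop σ]
      simp
    · have hkn : ¬ (n < k) := by omega
      rw [if_neg hkn, if_pos hk0, zero_sub]
      have hne : (chainSet σ k).Nonempty := ⟨σ ⟨0, by omega⟩, apply_mem_chainSet.mpr hk0⟩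
      have hnu : chainSet σ k ≠ univ := by
        intro h
        have hmem : σ ⟨k, hklt⟩ ∈ chainSet σ k := by rw [h]; exact mem_univ _
        exact apply_not_mem_chainSet σ hklt hmem
      have h1 := hεr _ hne hnu
      have h2 : ∑ i ∈ chainSet σ k, w i = -(zA (chainSet σ k) - zB (chainSet σ k)) := by
        rw [hw, sum_chainSet_ftVertex_sub h0A h0B σ hk]
      rw [h2]
      linarith
  have habel := abel_le Y V W (n + 1) hYmono hVW hpart
  -- the left-hand side of Abel: `ε (Y n − Y 0)`
  have hYV : ∑ m ∈ range (n + 1), Y m * V m = ε * (Y n - Y 0) := by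
    simp only [hV, mul_sub, Finset.sum_sub_distrib, mul_ite, mul_zero, Finset.sum_ite_eq', Finset.mem_range]
    simp
    ring
  have hYn : Y n = y (σ (Fin.last n)) := by
    simp only [hY]
    rw [alongChain_of_lt σ y (by omega : n < n + 1)]
    rfl
  have hY0 : Y 0 = y (σ 0) := by
    simp only [hY]
    rw [alongChain_of_lt σ y (by omega : 0 < n + 1)]
    rfl
  have hk1 : y k ≤ y (σ (Fin.last n)) := by
    have := hy (σ.symm k) (Fin.last n) (Fin.le_last _)
    simpa using this
  have hk2 : y (σ 0) ≤ y k' := by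
    have := hy 0 (σ.symm k') (Fin.zero_le _)
    simpa using this
  calc ε * (y k - y k') ≤ ε * (Y n - Y 0) := by
        rw [hYn, hY0]
        exact mul_le_mul_of_nonneg_left (by linarith) hε
    _ = ∑ m ∈ range (n + 1), Y m * V m := hYV.symm
    _ ≤ ∑ m ∈ range (n + 1), Y m * W m := habel
    _ = y ⬝ᵥ w := hdot.symm

/-- **The tropical weight is homogeneous of degree `0`** in the generalized-permutahedron case: `Π_i a_i^tr(e^{y+c𝟙})^{ν_i}/Π_j b_j^tr(e^{y+c𝟙})^{ρ_j} = Π_i a_i^tr(e^y)^{ν_i}/Π_j b_j^tr(e^y)^{ρ_j}` (on each chamber it is `e^{−⟨y, w_σ⟩}` with `⟨𝟙, w_σ⟩ = 0`; eq. (homogeneous)). [cite: Borinsky2020, eq. (homogeneous) (tropical.tex l.229–233); Lemma 16 / proof of Theorem 27 (l.702–710, l.1086–1094)] -/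
theorem tropWeight_add_const (ha : ∀ i, a i ≠ 0) (hb : ∀ j, b j ≠ 0) (hν : ∀ i, 0 ≤ ν i) (hρ : ∀ j, 0 ≤ ρ j)
    (hzA : Supermodular zA) (hzB : Supermodular zB) (h0A : zA ∅ = 0) (h0B : zB ∅ = 0)
    (hA : (∑ i, ν i • NP⟦a i⟧) = gpPolytope zA) (hB : (∑ j, ρ j • NP⟦b j⟧) = gpPolytope zB)
    (htop : zA univ = zB univ) (y : Fin (n + 1) → ℝ) (c : ℝ) :
    (∏ i, trop (a i) (fun k => exp (y k + c)) ^ ν i) / ∏ j, trop (b j) (fun k => exp (y k + c)) ^ ρ j =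
      (∏ i, trop (a i) (fun k => exp (y k)) ^ ν i) / ∏ j, trop (b j) (fun k => exp (y k)) ^ ρ j := by
  set σ := Tuple.sort y with hσdef
  have hy : y ∈ weylChamber σ := mem_weylChamber_sort y
  have hy' : (fun m => y m + c) ∈ weylChamber σ := add_const_mem_weylChamber hy c
  have h1 := prod_trop_rpow_div_eq_exp_neg_dotProduct_of_gp a b ha hb hν hρ hzA hzB h0A h0B hA hB hy
  have h2 := prod_trop_rpow_div_eq_exp_neg_dotProduct_of_gp a b ha hb hν hρ hzA hzB h0A h0B hA hB hy'
  rw [h2, h1]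
  congr 2
  simp only [dotProduct, add_mul, Finset.sum_add_distrib]
  rw [← Finset.mul_sum, sum_ftVertex_sub_eq_zero h0A h0B htop σ, mul_zero, add_zero]

/-- The tropical weight `y ↦ Π_i a_i^tr(e^y)^{ν_i}/Π_j b_j^tr(e^y)^{ρ_j}` is continuous (it is `exp` of a difference of support functions, eq. (atrbtr_exp)). Plumbing. [cite: Borinsky2020, eq. (atrbtr_exp) (tropical.tex l.663–666); Proposition 7] -/
theorem continuous_tropWeight (ha : ∀ i, a i ≠ 0) (hb : ∀ j, b j ≠ 0) :
    Continuous fun y : Fin (n + 1) → ℝ =>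
      (∏ i, trop (a i) (fun k => exp (y k)) ^ ν i) / ∏ j, trop (b j) (fun k => exp (y k)) ^ ρ j := by
  have h : (fun y : Fin (n + 1) → ℝ =>
      (∏ i, trop (a i) (fun k => exp (y k)) ^ ν i) / ∏ j, trop (b j) (fun k => exp (y k)) ^ ρ j) =
      fun y => exp ((∑ i, ν i * faceValue (a i) y) - ∑ j, ρ j * faceValue (b j) y) :=
    funext fun y => prod_trop_rpow_div_eq_exp a b ν ρ ha hb y
  rw [h]
  exact continuous_exp.comp ((continuous_finsetSum _ fun i _ => continuous_const.mul (continuous_faceValue (ha i))).sub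
    (continuous_finsetSum _ fun j _ => continuous_const.mul (continuous_faceValue (hb j))))

end GeneralizedPermutahedra

section Main

open MeasureTheory Real Finset Matrix MvPolynomial

open scoped Pointwise

variable {n : ℕ} {ι κ : Type*} [Fintype ι] [Fintype κ]
  (a : ι → MvPolynomial (Fin (n + 1)) ℝ) (b : κ → MvPolynomial (Fin (n + 1)) ℝ) (ν : ι → ℝ) (ρ : κ → ℝ)
  {zA zB : Finset (Fin (n + 1)) → ℝ}

/-- The chart map `y ↦ (y, 0)` (`x_n = 1` in logarithmic coordinates) is continuous. Plumbing. [cite: Borinsky2020, eq. (integral_euler_mellin) (tropical.tex l.237–241)] -/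
theorem continuous_snoc_zero : Continuous fun y : Fin n → ℝ => (Fin.snoc (α := fun _ => ℝ) y 0 : Fin (n + 1) → ℝ) := by
  refine continuous_pi fun k => ?_
  refine Fin.lastCases ?_ (fun i => ?_) k
  · simp only [Fin.snoc_last]
    exact continuous_const
  · simp only [Fin.snoc_castSucc]
    exact continuous_apply i

/-- **Theorem 27 (geometric sector decomposition for generalized permutahedra)**, in the chart `x_n = 1` of eq. (integral_euler_mellin), `x = e^{(y,0)}`: if `𝒜 = Σ_i ν_i NP_{a_i} = 𝒢_{z_𝒜}` and `ℬ = Σ_j ρ_j NP_{b_j} = 𝒢_{z_ℬ}` are generalized permutahedra (supermodular `z`, `z(∅) = 0`) with `r(A) = z_𝒜(A) − z_ℬ(A) > 0` for every non-empty proper `A ⊊ [n]` and `z_𝒜([n]) = z_ℬ([n])`, then for every bounded measurable `f` homogeneous of degree `0` on the positive orthant, "I[f] = ∫ (Π_i a_i^tr(x)^{ν_i}/Π_j b_j^tr(x)^{ρ_j}) f(x) Ω = Σ_{σ∈S_n} I_σ[f] with I_σ[f] = (1/Π_{k=1}^{n−1} r(A^σ_k)) ∫_{[0,1]^{n−1}}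 f(x^{(σ)}(ξ)) Π dξ_k", "x_{σ(k)} = Π_{i=k}^{n−1} ξ_i^{1/r(A^σ_i)} and x_{σ(n)} = 1" (typed 0-indexed in `n + 1` variables: `x^{(σ)}(ξ)_m = Π_{i ≥ σ⁻¹(m)} ξ_i^{1/r(A^σ_{i+1})}`). The print assumes R1 ∧ R2 and derives `r > 0` in the proof; here `r > 0` is the hypothesis (R2 follows by Corollary 24, R1 is not needed). [cite: Borinsky2020, Theorem 27 and its proof (tropical.tex l.1063–1096) (= AIHPD 10 (2023) Thm 6.6); Lemma 17 (l.742–774); eq. (integral_euler_mellin) (l.237–241)] -/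
theorem integral_tropical_mul_eq_sum_perm_of_gp (ha : ∀ i, a i ≠ 0) (hb : ∀ j, b j ≠ 0) (hν : ∀ i, 0 ≤ ν i)
    (hρ : ∀ j, 0 ≤ ρ j) (hzA : Supermodular zA) (hzB : Supermodular zB) (h0A : zA ∅ = 0) (h0B : zB ∅ = 0)
    (hA : (∑ i, ν i • NP⟦a i⟧) = gpPolytope zA) (hB : (∑ j, ρ j • NP⟦b j⟧) = gpPolytope zB)
    (hr : ∀ A : Finset (Fin (n + 1)), A.Nonempty → A ≠ univ → zB A < zA A) (htop : zA univ = zB univ)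
    (f : (Fin (n + 1) → ℝ) → ℝ) (hfm : Measurable f) (hfb : ∃ C, ∀ x, |f x| ≤ C)
    (hf0 : ∀ (c : ℝ), 0 < c → ∀ x : Fin (n + 1) → ℝ, (∀ k, 0 < x k) → f (fun k => c * x k) = f x) :
    ∫ y : Fin n → ℝ, (∏ i, trop (a i) (fun k => exp (Fin.snoc (α := fun _ => ℝ) y 0 k)) ^ ν i) /
        (∏ j, trop (b j) (fun k => exp (Fin.snoc (α := fun _ => ℝ) y 0 k)) ^ ρ j) *
        f (fun k => exp (Fin.snoc (α := fun _ => ℝ) y 0 k)) =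
      ∑ σ : Equiv.Perm (Fin (n + 1)),
        (∏ i : Fin n, 1 / (zA (chainSet σ ((i : ℕ) + 1)) - zB (chainSet σ ((i : ℕ) + 1)))) *
        ∫ ξ in unitCube n, f (fun m => ∏ i ∈ univ.filter (fun i : Fin n => ((σ.symm m : Fin (n + 1)) : ℕ) ≤ (i : ℕ)),
          ξ i ^ (1 / (zA (chainSet σ ((i : ℕ) + 1)) - zB (chainSet σ ((i : ℕ) + 1))))) := by
  set T : (Fin (n + 1) → ℝ) → ℝ := fun y =>
    (∏ i, trop (a i) (fun k => exp (y k)) ^ ν i) / ∏ j, trop (b j) (fun k => exp (y k)) ^ ρ j with hT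
  set H : (Fin (n + 1) → ℝ) → ℝ := fun y => T y * f (fun k => exp (y k)) with hH
  set h : ℝ → ℝ := Set.indicator (Set.Icc 0 1) (1 : ℝ → ℝ) with hh
  -- the test function in logarithmic coordinates is `𝟙`-translation invariant
  have hG : ∀ (y : Fin (n + 1) → ℝ) (c : ℝ), f (fun k => exp (y k + c)) = f (fun k => exp (y k)) := by
    intro y c
    have : (fun k => exp (y k + c)) = fun k => exp c * exp (y k) := by
      funext k; rw [exp_add, mul_comm]
    rw [this, hf0 (exp c) (exp_pos c) _ (fun k => exp_pos _)]
  have hHinv : ∀ (y : Fin (n + 1) → ℝ) (c : ℝ), H (fun m => y m + c) = H y := by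
    intro y c
    simp only [hH, hT]
    rw [tropWeight_add_const ha hb hν hρ hzA hzB h0A h0B hA hB htop y c, hG]
  have hh1 : ∫ s, h s = 1 := by
    simp only [hh]
    rw [integral_indicator_one measurableSet_Icc, Real.volume_real_Icc_of_le zero_le_one, sub_zero]
  have hhint : Integrable h := by
    simp only [hh]
    rw [integrable_indicator_iff measurableSet_Icc]
    exact integrableOn_const (by rw [Real.volume_Icc]; exact ENNReal.ofReal_ne_top)
  -- the gap of Lemma 15 holds, hence the tropical weight is integrable on the chart
  obtain ⟨ε, hε, hεr⟩ := exists_pos_le_rate hr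
  have hgap := gap_of_gp ha hb hν hρ hzA hzB h0A h0B hA hB htop hε.le hεr
  have hTint : Integrable (fun y : Fin n → ℝ => T (Fin.snoc (α := fun _ => ℝ) y 0)) :=
    integrable_tropical_of_gap a b ν ρ ha hb hε hgap
  obtain ⟨C, hC⟩ := hfb
  have hFm : AEStronglyMeasurable (fun y : Fin n → ℝ => f (fun k => exp (Fin.snoc (α := fun _ => ℝ) y 0 k))) volume :=
    (hfm.comp continuous_expSnoc.measurable).aestronglyMeasurable
  have hH0 : Integrable (fun y : Fin n → ℝ => H (Fin.snoc (α := fun _ => ℝ) y 0)) :=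
    hTint.mul_bdd hFm (Filter.Eventually.of_forall fun y => by rw [Real.norm_eq_abs]; exact hC _)
  -- Step 1: the chart integral as a `𝟙`-average over `ℝ^{n+1}`
  have step1 : ∫ y : Fin n → ℝ, H (Fin.snoc (α := fun _ => ℝ) y 0) = ∫ y, H y * h (y (Fin.last n)) := by
    rw [integral_mul_apply_last_eq H hHinv h, hh1, one_mul]
  -- Step 2: the sector sum
  have hInt : Integrable (fun y : Fin (n + 1) → ℝ => H y * h (y (Fin.last n))) :=
    integrable_mul_apply_last H hHinv hhint hH0
  have step2 := integral_eq_sum_integral_weylChamber (μ := (volume : Measure (Fin (n + 1) → ℝ)))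
    Measure.AbsolutelyContinuous.rfl hInt
  -- Step 3: each sector
  have step3 : ∀ σ : Equiv.Perm (Fin (n + 1)), ∫ y in weylChamber σ, H y * h (y (Fin.last n)) =
      (∏ i : Fin n, 1 / (zA (chainSet σ ((i : ℕ) + 1)) - zB (chainSet σ ((i : ℕ) + 1)))) *
        ∫ ξ in unitCube n, f (fun m => ∏ i ∈ univ.filter (fun i : Fin n => ((σ.symm m : Fin (n + 1)) : ℕ) ≤ (i : ℕ)),
          ξ i ^ (1 / (zA (chainSet σ ((i : ℕ) + 1)) - zB (chainSet σ ((i : ℕ) + 1))))) := by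
    intro σ
    set w : Fin (n + 1) → ℝ := ftVertex zB σ - ftVertex zA σ with hw
    have hcong : ∀ y ∈ weylChamber σ,
        H y * h (y (Fin.last n)) = f (fun k => exp (y k)) * exp (-(y ⬝ᵥ w)) * h (y (Fin.last n)) := by
      intro y hy
      simp only [hH, hT]
      rw [prod_trop_rpow_div_eq_exp_neg_dotProduct_of_gp a b ha hb hν hρ hzA hzB h0A h0B hA hB hy]
      ring
    rw [setIntegral_congr_fun (measurableSet_weylChamber σ) hcong]
    have hwsum : ∑ m, w m = 0 := sum_ftVertex_sub_eq_zero h0A h0B htop σ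
    have hcr : ∀ i : Fin n, -∑ m ∈ chainSet σ ((i : ℕ) + 1), w m =
        zA (chainSet σ ((i : ℕ) + 1)) - zB (chainSet σ ((i : ℕ) + 1)) :=
      fun i => neg_sum_chainSet_ftVertex_sub h0A h0B σ i
    have hc : ∀ i : Fin n, 0 < -∑ m ∈ chainSet σ ((i : ℕ) + 1), w m := fun i => by
      rw [hcr]; exact chainSet_rate_pos hr σ i
    rw [setIntegral_weylChamber_mul_exp_eq_unitCube σ (fun y => f (fun k => exp (y k))) hG w hwsum hc h, hh1, one_mul]
    simp only [hcr]
    congr 1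
    refine setIntegral_congr_fun measurableSet_unitCube fun ξ hξ => ?_
    congr 1
    funext m
    rw [exp_sum]
    refine Finset.prod_congr rfl fun i _ => ?_
    rw [Real.rpow_def_of_pos ((mem_unitCube.mp hξ) i).1]
    congr 1
    ring
  -- assemble
  calc ∫ y : Fin n → ℝ, (∏ i, trop (a i) (fun k => exp (Fin.snoc (α := fun _ => ℝ) y 0 k)) ^ ν i) /
        (∏ j, trop (b j) (fun k => exp (Fin.snoc (α := fun _ => ℝ) y 0 k)) ^ ρ j) *
        f (fun k => exp (Fin.snoc (α := fun _ => ℝ) y 0 k))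
      = ∫ y : Fin n → ℝ, H (Fin.snoc (α := fun _ => ℝ) y 0) := rfl
    _ = ∫ y, H y * h (y (Fin.last n)) := step1
    _ = ∑ σ : Equiv.Perm (Fin (n + 1)), ∫ y in weylChamber σ, H y * h (y (Fin.last n)) := step2
    _ = _ := Finset.sum_congr rfl fun σ _ => step3 σ

/-- **Eq. (40): `I^tr = Σ_{σ∈S_n} I^tr_{C_σ}` with `I^tr_{C_σ} = 1/Π_{k=1}^{n−1} r(A^σ_k)`** ("This equation is just eq. (def_Itr_secdec) specified using Theorem 27 to the generalized permutahedron case") — Theorem 27 with `f ≡ 1`, for `I^tr = ∫_{ℝⁿ} Π_i a_i^tr(e^{(y,0)})^{ν_i}/Π_j b_j^tr(e^{(y,0)})^{ρ_j} dy`, the normalisation of `μ^tr` in the chart `x_n = 1`. [cite: Borinsky2020, eq. (40) (tropical.tex l.1102–1106) (= AIHPD eq. (6.4)); Theorem 27 (l.1063–1085); eq. (integral_trop) (l.887)] -/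
theorem integral_tropical_eq_sum_perm_of_gp (ha : ∀ i, a i ≠ 0) (hb : ∀ j, b j ≠ 0) (hν : ∀ i, 0 ≤ ν i)
    (hρ : ∀ j, 0 ≤ ρ j) (hzA : Supermodular zA) (hzB : Supermodular zB) (h0A : zA ∅ = 0) (h0B : zB ∅ = 0)
    (hA : (∑ i, ν i • NP⟦a i⟧) = gpPolytope zA) (hB : (∑ j, ρ j • NP⟦b j⟧) = gpPolytope zB)
    (hr : ∀ A : Finset (Fin (n + 1)), A.Nonempty → A ≠ univ → zB A < zA A) (htop : zA univ = zB univ) :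
    ∫ y : Fin n → ℝ, (∏ i, trop (a i) (fun k => exp (Fin.snoc (α := fun _ => ℝ) y 0 k)) ^ ν i) /
        ∏ j, trop (b j) (fun k => exp (Fin.snoc (α := fun _ => ℝ) y 0 k)) ^ ρ j =
      ∑ σ : Equiv.Perm (Fin (n + 1)), ∏ i : Fin n, 1 / (zA (chainSet σ ((i : ℕ) + 1)) - zB (chainSet σ ((i : ℕ) + 1))) := by
  have h := integral_tropical_mul_eq_sum_perm_of_gp a b ν ρ ha hb hν hρ hzA hzB h0A h0B hA hB hr htop (fun _ => 1)
    measurable_const ⟨1, fun _ => by simp⟩ (fun _ _ _ _ => rfl)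
  simp only [mul_one] at h
  rw [h]
  refine Finset.sum_congr rfl fun σ _ => ?_
  rw [setIntegral_const, smul_eq_mul, mul_one]
  have hvol : (volume : Measure (Fin n → ℝ)).real (unitCube n) = 1 := by
    rw [measureReal_def, unitCube, Real.volume_pi_Ioo]
    simp
  rw [hvol, mul_one]

/-- **Proposition 29: `I^tr = J_r([n])`** for the `2ⁿ`-table `J_r` of Definition 28 (`SectorTableRecursion.sectorTable`, with the printed convention `r(∅) = 1`), in the chart `x_n = 1`. [cite: Borinsky2020, Proposition 29 and its proof (tropical.tex l.1112–1122) (= AIHPD Prop. 6.8); Definition 28 (l.1107–1111); eq. (40) (l.1102–1106)] -/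
theorem integral_tropical_eq_sectorTable_of_gp (ha : ∀ i, a i ≠ 0) (hb : ∀ j, b j ≠ 0) (hν : ∀ i, 0 ≤ ν i)
    (hρ : ∀ j, 0 ≤ ρ j) (hzA : Supermodular zA) (hzB : Supermodular zB) (h0A : zA ∅ = 0) (h0B : zB ∅ = 0)
    (hA : (∑ i, ν i • NP⟦a i⟧) = gpPolytope zA) (hB : (∑ j, ρ j • NP⟦b j⟧) = gpPolytope zB)
    (hr : ∀ A : Finset (Fin (n + 1)), A.Nonempty → A ≠ univ → zB A < zA A) (htop : zA univ = zB univ) :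
    ∫ y : Fin n → ℝ, (∏ i, trop (a i) (fun k => exp (Fin.snoc (α := fun _ => ℝ) y 0 k)) ^ ν i) /
        ∏ j, trop (b j) (fun k => exp (Fin.snoc (α := fun _ => ℝ) y 0 k)) ^ ρ j =
      sectorTable (fun A : Finset (Fin (n + 1)) => if A = ∅ then (1 : ℝ) else zA A - zB A) univ := by
  rw [integral_tropical_eq_sum_perm_of_gp a b ν ρ ha hb hν hρ hzA hzB h0A h0B hA hB hr htop,
    ← sum_perm_prod_inv_eq_sectorTable _ (if_pos rfl)]
  refine Finset.sum_congr rfl fun σ _ => Finset.prod_congr rfl fun i _ => ?_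
  rw [if_neg (chainSet_succ_nonempty σ i).ne_empty, one_div]

/-- **Proposition 31: Algorithm 4 generates samples from `μ^tr` — expectation form, as in the printed proof.** Algorithm 4 ("Set A = [n] and κ = 1. while A ≠ ∅: Pick a random e ∈ A with probability p_e = (1/J_r(A)) J_r(A∖e)/r(A∖e). Remove e from A … Set σ(|A|) = e. Set x_e = κ. Pick a uniformly distributed random number ξ ∈ [0,1]. Set κ ← κ ξ^{1/r(A)}.") removes `σ(n), …, σ(0)` in this order with probability `runProb r [n] (σ(n), …, σ(0))` (the product of the `p_e` along the run, `SectorTableRecursion.runProb`; the `ξ`'s are drawn independently of the `e`'s) and then returns `x^{(σ)}(ξ)`, `x_{σ(k)} = Π_{i ≥ k} ξ_i^{1/r(A^σ_{i+1})}`, `ξ` uniform on `[0,1]^n`; so for every bounded measurable degree-0-homogeneous `f`, "E[f(x)] = Σ … ∫_{[0,1]^{n−1}} f(x(ξ)) Π dξ_k" equals `∫ f dμ^tr`, `μ^tr` the tropical probability measure of eq. (mu_probability) — here on the chart `x_n = 1`, `x = e^{(y,0)}`, with Lebesgue density `T/I^tr` exactly as typed in `ConvergenceTheorem.isProbabilityMeasure_tropicalMeasure_of_gap`.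 "The statement follows from Proposition 29 and Theorem 27." [cite: Borinsky2020, Algorithm 4 (tropical.tex l.1126–1144); Proposition 31 and its proof (l.1146–1158) (= AIHPD Prop. 6.10); eq. (mu_probability) (l.890–893) (= AIHPD eq. (5.2))] -/
theorem algorithm4_expectation_eq_integral_tropicalMeasure (ha : ∀ i, a i ≠ 0) (hb : ∀ j, b j ≠ 0) (hν : ∀ i, 0 ≤ ν i)
    (hρ : ∀ j, 0 ≤ ρ j) (hzA : Supermodular zA) (hzB : Supermodular zB) (h0A : zA ∅ = 0) (h0B : zB ∅ = 0)
    (hA : (∑ i, ν i • NP⟦a i⟧) = gpPolytope zA) (hB : (∑ j, ρ j • NP⟦b j⟧) = gpPolytope zB)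
    (hr : ∀ A : Finset (Fin (n + 1)), A.Nonempty → A ≠ univ → zB A < zA A) (htop : zA univ = zB univ)
    (f : (Fin (n + 1) → ℝ) → ℝ) (hfm : Measurable f) (hfb : ∃ C, ∀ x, |f x| ≤ C)
    (hf0 : ∀ (c : ℝ), 0 < c → ∀ x : Fin (n + 1) → ℝ, (∀ k, 0 < x k) → f (fun k => c * x k) = f x) :
    ∑ σ : Equiv.Perm (Fin (n + 1)),
        runProb (fun A : Finset (Fin (n + 1)) => if A = ∅ then (1 : ℝ) else zA A - zB A) univ (List.ofFn ⇑σ).reverse *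
        ∫ ξ in unitCube n, f (fun m => ∏ i ∈ univ.filter (fun i : Fin n => ((σ.symm m : Fin (n + 1)) : ℕ) ≤ (i : ℕ)),
          ξ i ^ (1 / (zA (chainSet σ ((i : ℕ) + 1)) - zB (chainSet σ ((i : ℕ) + 1))))) =
      ∫ y : Fin n → ℝ, f (fun k => exp (Fin.snoc (α := fun _ => ℝ) y 0 k))
        ∂((volume : Measure (Fin n → ℝ)).withDensity fun y => ENNReal.ofReal
          (((∏ i, trop (a i) (fun k => exp (Fin.snoc (α := fun _ => ℝ) y 0 k)) ^ ν i) /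
              ∏ j, trop (b j) (fun k => exp (Fin.snoc (α := fun _ => ℝ) y 0 k)) ^ ρ j) /
            ∫ y' : Fin n → ℝ, (∏ i, trop (a i) (fun k => exp (Fin.snoc (α := fun _ => ℝ) y' 0 k)) ^ ν i) /
              ∏ j, trop (b j) (fun k => exp (Fin.snoc (α := fun _ => ℝ) y' 0 k)) ^ ρ j)) := by
  set r' : Finset (Fin (n + 1)) → ℝ := fun A => if A = ∅ then (1 : ℝ) else zA A - zB A with hr'
  set T : (Fin n → ℝ) → ℝ := fun y => (∏ i, trop (a i) (fun k => exp (Fin.snoc (α := fun _ => ℝ) y 0 k)) ^ ν i) /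
    ∏ j, trop (b j) (fun k => exp (Fin.snoc (α := fun _ => ℝ) y 0 k)) ^ ρ j with hT
  have hr0 : r' ∅ = 1 := if_pos rfl
  have hr'pos : ∀ B : Finset (Fin (n + 1)), B ⊂ univ → 0 < r' B := by
    intro B hB
    by_cases hBe : B = ∅
    · rw [hBe, hr0]; exact one_pos
    · simp only [hr', if_neg hBe]
      exact sub_pos.mpr (hr B (Finset.nonempty_iff_ne_empty.mpr hBe) hB.ne)
  obtain ⟨ε, hε, hεr⟩ := exists_pos_le_rate hr
  have hgap := gap_of_gp ha hb hν hρ hzA hzB h0A h0B hA hB htop hε.le hεr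
  have hI : 0 < ∫ y, T y := integral_tropical_pos_of_gap a b ν ρ ha hb hε hgap
  have hItab : ∫ y, T y = sectorTable r' univ :=
    integral_tropical_eq_sectorTable_of_gp a b ν ρ ha hb hν hρ hzA hzB h0A h0B hA hB hr htop
  have hTm : Measurable T :=
    ((continuous_tropWeight (ν := ν) (ρ := ρ) ha hb).comp continuous_snoc_zero).measurable
  have hT0 : ∀ y, 0 ≤ T y := fun y =>
    (div_pos (Finset.prod_pos fun i _ => Real.rpow_pos_of_pos (trop_pos (fun _ => exp_pos _) (ha i)) _)
      (Finset.prod_pos fun j _ => Real.rpow_pos_of_pos (trop_pos (fun _ => exp_pos _) (hb j)) _)).le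
  have key := integral_mul_eq_integral_mul_integral_withDensity (vol := (volume : Measure (Fin n → ℝ))) hTm hT0 hI
    (fun y => f (fun k => exp (Fin.snoc (α := fun _ => ℝ) y 0 k)))
  -- `∫ f dμ^tr = (∫ T f) / I^tr`
  have hrhs : ∫ y : Fin n → ℝ, f (fun k => exp (Fin.snoc (α := fun _ => ℝ) y 0 k))
        ∂((volume : Measure (Fin n → ℝ)).withDensity fun y => ENNReal.ofReal (T y / ∫ y', T y')) =
      (∫ y, T y * f (fun k => exp (Fin.snoc (α := fun _ => ℝ) y 0 k))) / ∫ y, T y := by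
    rw [key, mul_div_cancel_left₀ _ hI.ne']
  rw [hrhs, integral_tropical_mul_eq_sum_perm_of_gp a b ν ρ ha hb hν hρ hzA hzB h0A h0B hA hB hr htop f hfm hfb hf0,
    Finset.sum_div]
  refine Finset.sum_congr rfl fun σ _ => ?_
  rw [runProb_reverse_ofFn r' hr0 hr'pos σ, ← hItab]
  have hri : ∀ i : Fin n, (r' (chainSet σ ((i : ℕ) + 1)))⁻¹ = 1 / (zA (chainSet σ ((i : ℕ) + 1)) - zB (chainSet σ ((i : ℕ) + 1))) := by
    intro i
    simp only [hr', if_neg (chainSet_succ_nonempty σ i).ne_empty, one_div]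
  simp only [hri]
  ring

/-- **Proposition 31 as an identity of measures ("generates a sample x ∈ ℙ^{n−1}_{>0}, distributed as μ^tr").** The law of Algorithm 4's output `x`, read in the chart `x_n = 1` through `x ↦ (log(x_j/x_n))_{j<n}` — the finite mixture over `σ ∈ S_{n+1}` with weights `runProb r [n] (σ(n), …, σ(0))` of the images of the uniform law on `[0,1]^n` under `ξ ↦ (log(x^{(σ)}(ξ)_j / x^{(σ)}(ξ)_n))_{j<n}` — IS the tropical probability measure `μ^tr` of eq. (mu_probability) (Lebesgue density `T/I^tr` on the chart, as in `ConvergenceTheorem.lean`): the input law `μ` that `TropicalSamplingEstimator.lean` takes abstractly. [cite: Borinsky2020, Proposition 31 (tropical.tex l.1146–1149) (= AIHPD Prop. 6.10); Algorithm 4 (l.1126–1144); eq. (mu_probability) (l.890–893)] -/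
theorem algorithm4_law_eq_tropicalMeasure (ha : ∀ i, a i ≠ 0) (hb : ∀ j, b j ≠ 0) (hν : ∀ i, 0 ≤ ν i)
    (hρ : ∀ j, 0 ≤ ρ j) (hzA : Supermodular zA) (hzB : Supermodular zB) (h0A : zA ∅ = 0) (h0B : zB ∅ = 0)
    (hA : (∑ i, ν i • NP⟦a i⟧) = gpPolytope zA) (hB : (∑ j, ρ j • NP⟦b j⟧) = gpPolytope zB)
    (hr : ∀ A : Finset (Fin (n + 1)), A.Nonempty → A ≠ univ → zB A < zA A) (htop : zA univ = zB univ) :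
    (∑ σ : Equiv.Perm (Fin (n + 1)),
        ENNReal.ofReal (runProb (fun A : Finset (Fin (n + 1)) => if A = ∅ then (1 : ℝ) else zA A - zB A) univ
          (List.ofFn ⇑σ).reverse) •
        ((volume : Measure (Fin n → ℝ)).restrict (unitCube n)).map (fun ξ : Fin n → ℝ => fun j : Fin n =>
          Real.log (∏ i ∈ univ.filter (fun i : Fin n => ((σ.symm (Fin.castSucc j) : Fin (n + 1)) : ℕ) ≤ (i : ℕ)),
              ξ i ^ (1 / (zA (chainSet σ ((i : ℕ) + 1)) - zB (chainSet σ ((i : ℕ) + 1))))) -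
          Real.log (∏ i ∈ univ.filter (fun i : Fin n => ((σ.symm (Fin.last n) : Fin (n + 1)) : ℕ) ≤ (i : ℕ)),
              ξ i ^ (1 / (zA (chainSet σ ((i : ℕ) + 1)) - zB (chainSet σ ((i : ℕ) + 1))))))) =
      (volume : Measure (Fin n → ℝ)).withDensity fun y => ENNReal.ofReal
          (((∏ i, trop (a i) (fun k => exp (Fin.snoc (α := fun _ => ℝ) y 0 k)) ^ ν i) /
              ∏ j, trop (b j) (fun k => exp (Fin.snoc (α := fun _ => ℝ) y 0 k)) ^ ρ j) /
            ∫ y' : Fin n → ℝ, (∏ i, trop (a i) (fun k => exp (Fin.snoc (α := fun _ => ℝ) y' 0 k)) ^ ν i) /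
              ∏ j, trop (b j) (fun k => exp (Fin.snoc (α := fun _ => ℝ) y' 0 k)) ^ ρ j) := by
  set r' : Finset (Fin (n + 1)) → ℝ := fun A => if A = ∅ then (1 : ℝ) else zA A - zB A with hr'
  set μtr : Measure (Fin n → ℝ) := (volume : Measure (Fin n → ℝ)).withDensity fun y => ENNReal.ofReal
          (((∏ i, trop (a i) (fun k => exp (Fin.snoc (α := fun _ => ℝ) y 0 k)) ^ ν i) /
              ∏ j, trop (b j) (fun k => exp (Fin.snoc (α := fun _ => ℝ) y 0 k)) ^ ρ j) /
            ∫ y' : Fin n → ℝ, (∏ i, trop (a i) (fun k => exp (Fin.snoc (α := fun _ => ℝ) y' 0 k)) ^ ν i) /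
              ∏ j, trop (b j) (fun k => exp (Fin.snoc (α := fun _ => ℝ) y' 0 k)) ^ ρ j) with hμtr
  -- the chart `x ↦ (log x_j − log x_n)_j` and the sample maps `ξ ↦ x^{(σ)}(ξ)`
  set chart : (Fin (n + 1) → ℝ) → (Fin n → ℝ) := fun x j => Real.log (x (Fin.castSucc j)) - Real.log (x (Fin.last n))
    with hchart
  set X : Equiv.Perm (Fin (n + 1)) → (Fin n → ℝ) → (Fin (n + 1) → ℝ) := fun σ ξ m =>
    ∏ i ∈ univ.filter (fun i : Fin n => ((σ.symm m : Fin (n + 1)) : ℕ) ≤ (i : ℕ)),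
      ξ i ^ (1 / (zA (chainSet σ ((i : ℕ) + 1)) - zB (chainSet σ ((i : ℕ) + 1)))) with hX
  have hchartm : Measurable chart :=
    measurable_pi_lambda _ fun j => ((Real.measurable_log.comp (measurable_pi_apply _)).sub
      (Real.measurable_log.comp (measurable_pi_apply _)))
  have hXm : ∀ σ, Measurable (X σ) := fun σ =>
    measurable_pi_lambda _ fun m => Finset.measurable_prod _ fun i _ => (measurable_pi_apply i).pow_const _
  have hgm : ∀ σ, Measurable (fun ξ => chart (X σ ξ)) := fun σ => hchartm.comp (hXm σ)
  have hr'pos : ∀ B : Finset (Fin (n + 1)), B ⊂ univ → 0 < r' B := by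
    intro B hB
    by_cases hBe : B = ∅
    · rw [hBe]; simp [hr']
    · simp only [hr', if_neg hBe]
      exact sub_pos.mpr (hr B (Finset.nonempty_iff_ne_empty.mpr hBe) hB.ne)
  obtain ⟨ε, hε, hεr⟩ := exists_pos_le_rate hr
  have hgap := gap_of_gp ha hb hν hρ hzA hzB h0A h0B hA hB htop hε.le hεr
  haveI : IsProbabilityMeasure μtr := isProbabilityMeasure_tropicalMeasure_of_gap a b ν ρ ha hb hε hgap
  change (∑ σ : Equiv.Perm (Fin (n + 1)), ENNReal.ofReal (runProb r' univ (List.ofFn ⇑σ).reverse) •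
      ((volume : Measure (Fin n → ℝ)).restrict (unitCube n)).map (fun ξ => chart (X σ ξ))) = μtr
  ext s hs
  -- evaluate both sides on `s` through the expectation of the test function `𝟙_s ∘ chart`
  set f : (Fin (n + 1) → ℝ) → ℝ := fun x => s.indicator (1 : (Fin n → ℝ) → ℝ) (chart x) with hf
  have hfm : Measurable f := (measurable_one.indicator hs).comp hchartm
  have hf1 : ∀ x, |f x| ≤ 1 := by
    intro x
    simp only [hf]
    by_cases hx : chart x ∈ s
    · rw [Set.indicator_of_mem hx]; simp
    · rw [Set.indicator_of_notMem hx]; simp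
  have hf0 : ∀ (c : ℝ), 0 < c → ∀ x : Fin (n + 1) → ℝ, (∀ k, 0 < x k) → f (fun k => c * x k) = f x := by
    intro c hc x hx
    simp only [hf, hchart]
    congr 1
    funext j
    rw [Real.log_mul hc.ne' (hx _).ne', Real.log_mul hc.ne' (hx _).ne']
    ring
  have key := algorithm4_expectation_eq_integral_tropicalMeasure a b ν ρ ha hb hν hρ hzA hzB h0A h0B hA hB hr htop
    f hfm ⟨1, hf1⟩ hf0
  rw [← hμtr] at key
  -- the right-hand side of `key` is `μ^tr(s)`
  have hchart_exp : ∀ y : Fin n → ℝ, chart (fun k => exp (Fin.snoc (α := fun _ => ℝ) y 0 k)) = y := by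
    intro y
    funext j
    simp [hchart, Real.log_exp]
  have hrhs : ∀ y : Fin n → ℝ, f (fun k => exp (Fin.snoc (α := fun _ => ℝ) y 0 k)) = s.indicator 1 y := by
    intro y
    simp only [hf]
    rw [hchart_exp]
  simp only [hrhs] at key
  rw [integral_indicator_one hs] at key
  -- the left-hand side of `key`, term by term, is `p_σ · vol(ξ ∈ [0,1]^n : chart (x^σ ξ) ∈ s)`
  have hlhs : ∀ σ : Equiv.Perm (Fin (n + 1)), ∫ ξ in unitCube n, f (X σ ξ) =
      (((volume : Measure (Fin n → ℝ)).restrict (unitCube n)).map (fun ξ => chart (X σ ξ))).real s := by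
    intro σ
    have h1 : (fun ξ => f (X σ ξ)) = ((fun ξ => chart (X σ ξ)) ⁻¹' s).indicator 1 := by
      funext ξ
      simp only [hf]
      by_cases hξ : chart (X σ ξ) ∈ s
      · rw [Set.indicator_of_mem hξ, Set.indicator_of_mem (show ξ ∈ (fun ξ => chart (X σ ξ)) ⁻¹' s from hξ)]
        rfl
      · rw [Set.indicator_of_notMem hξ, Set.indicator_of_notMem (show ξ ∉ (fun ξ => chart (X σ ξ)) ⁻¹' s from hξ)]
    rw [h1, integral_indicator_one (hs.preimage (hgm σ)), measureReal_def, measureReal_def,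
      Measure.map_apply (hgm σ) hs]
  have key2 : ∑ σ : Equiv.Perm (Fin (n + 1)), runProb r' univ (List.ofFn ⇑σ).reverse *
      (((volume : Measure (Fin n → ℝ)).restrict (unitCube n)).map (fun ξ => chart (X σ ξ))).real s = μtr.real s := by
    rw [← key]
    exact Finset.sum_congr rfl fun σ _ => congrArg _ (hlhs σ).symm
  -- pass from real numbers to `ℝ≥0∞`
  rw [Measure.coe_finsetSum, Finset.sum_apply]
  simp only [Measure.smul_apply, smul_eq_mul]
  haveI : IsFiniteMeasure ((volume : Measure (Fin n → ℝ)).restrict (unitCube n)) := by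
    refine isFiniteMeasure_restrict.mpr ?_
    rw [unitCube, Real.volume_pi_Ioo]
    simp
  have hfin : ∀ σ : Equiv.Perm (Fin (n + 1)),
      (((volume : Measure (Fin n → ℝ)).restrict (unitCube n)).map (fun ξ => chart (X σ ξ))) s ≠ ⊤ := by
    intro σ
    rw [Measure.map_apply (hgm σ) hs]
    exact measure_ne_top _ _
  calc ∑ σ : Equiv.Perm (Fin (n + 1)), ENNReal.ofReal (runProb r' univ (List.ofFn ⇑σ).reverse) *
        (((volume : Measure (Fin n → ℝ)).restrict (unitCube n)).map (fun ξ => chart (X σ ξ))) s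
      = ∑ σ : Equiv.Perm (Fin (n + 1)), ENNReal.ofReal (runProb r' univ (List.ofFn ⇑σ).reverse *
          (((volume : Measure (Fin n → ℝ)).restrict (unitCube n)).map (fun ξ => chart (X σ ξ))).real s) := by
        refine Finset.sum_congr rfl fun σ _ => ?_
        rw [ENNReal.ofReal_mul (runProb_nonneg r' hr'pos (reverse_ofFn_mem_orderings σ)), measureReal_def,
          ENNReal.ofReal_toReal (hfin σ)]
    _ = ENNReal.ofReal (∑ σ : Equiv.Perm (Fin (n + 1)), runProb r' univ (List.ofFn ⇑σ).reverse *
          (((volume : Measure (Fin n → ℝ)).restrict (unitCube n)).map (fun ξ => chart (X σ ξ))).real s) := by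
        rw [ENNReal.ofReal_sum_of_nonneg]
        intro σ _
        exact mul_nonneg (runProb_nonneg r' hr'pos (reverse_ofFn_mem_orderings σ)) measureReal_nonneg
    _ = μtr s := by
        rw [key2, measureReal_def, ENNReal.ofReal_toReal (measure_ne_top μtr s)]

end Main

end Literature.MathematicalPhysics.QuantumFieldTheory.Borinsky2020

end
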